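import Literature.MathematicalPhysics.QuantumManyBody.CubicTrialVector
import Literature.MathematicalPhysics.QuantumManyBody.BogoliubovExpansion
import HarnessLib

/-!
# Pairings of the cubic trial vector: Type-A contractions (one triple), Type-B contractions
# (two triples, at most four partners) and the decomposition `⟨ξ_ν, 𝒱_N^{(H)}ξ_ν⟩ = V₁ + B`

Topic `Literature/MathematicalPhysics/QuantumManyBody`, namespace `BoseGas.Fock`; theorem-only sequel
of `CubicTrialVector.lean` (the vector `ξ_ν = cubicVector e PH PS κ` as a sum over `θ`-admissible sets
of oriented triples, unique pairing, the triple contraction) and `BogoliubovExpansion.lean` (graded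
orthogonality), for the provefact
`Literature.MathematicalPhysics.QuantumManyBody.BoseGas.BastiCenatiempoSchlein2021_upperBound`,
§5.3 of [BastiCenatiempoSchlein2021] (the expectation of the quartic term `𝒱_N^{(H)}`).

The observable `a†_xa†_ya_{y'}a_{x'}` acting on an admissible monomial `X^{d(S')}` either annihilates
the hard pair of one triple `τ' ∈ S'` (**Type A**: `X^{d(S')-δ_{u'}-δ_{a'}} = X^{d(S'∖τ')+δ_{b'}}`,
`pderiv_pderiv_hardPair_monomial_setOcc`) or two hard modes of different triples (Type B, the error
terms `V₂` and the cross diagonal). After a Type-A annihilation, creating two hard modes `x, y` and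
pairing with `ξ_ν` selects exactly the admissible set `S'∖τ' ∪ {τ}` for the triple `τ = (x, y, b')`
(`fockInner_cubicVector_monomial_setOcc_add_tripleOcc`, by `TripleAdm.mem_of_setOcc_eq_add` and unique
pairing), and vanishes unless the created modes carry the right total momentum
(`fockInner_cubicVector_monomial_eq_zero_of_weight_ne`). This is the mechanism behind
[ibid., §5.3 case 1)] (`V₁`, including the diagonal `τ = τ'`), to be resummed over `(S', τ') ↦ S'∖τ'`.

**0. Structure lemmas** (`pair_eq_of_setOcc_add_eq`, `Triple.eq_of_b_eq_of_hard_mem`,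
`TripleAdm.hard_slots_of_sdiff_singleton`, `TripleAdm.sum_sum_ite_hard_occupied_ne`): the diagonal
pairing, the one-differing-triple case and the reindexing of occupied hard modes by the triples.

**II. Type B and the decomposition.** If the annihilated `x', y'` lie in two *different* triples
`τ₁ ≠ τ₂` of `S'` (case 2) of [ibid., §5.3]), a matching admissible `S ≠ S'` replaces exactly these two
triples (`TripleAdm.sdiff_eq_pair_of_cross`) by two triples re-pairing the spare hard slots and the
soft slots crosswise (`TripleAdm.cross_slots`), so a cross pair has at most four partners
(`TripleAdm.card_partners_le_four`, `sum_partners_le_four`); a same-triple pair never matches a cross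
pair (`TripleAdm.no_partner_same_cross`). Expanding `a_{y'}a_{x'}ξ_ν` over `S'` and sorting the
annihilated pair into same-triple and cross pairs (`TripleAdm.ite_occupied_ne_eq`,
`quartic_sum_eq_same_add_cross`), the same-triple part is the Type-A sum above
(`quartic_same_eq_typeA_freed`) and the cross part is bounded by Schur's test with the two partner
counts, `|B| ≤ 16K₀ ∑_S|c_S|²|S|²` (`norm_quartic_cross_le`; `sum_normSq_setCoeff_mul_card_sq_le`).
The result is `quartic_pairing_decomposition`:
`∑_{x,y,x',y'∈P_H} K ⟨a_ya_xξ_ν, a_{y'}a_{x'}ξ_ν⟩ = ∑_{τ',τ : b=b'} κ_{τ'}conj(κ_τ)K̃(τ,τ')(‖ξ_ν‖² - D₂(τ',τ)) + B`,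
the exact form of `⟨ξ_ν, 𝒱_N^{(H)}ξ_ν⟩ = I_𝒱 + J_𝒱 + V₂` [ibid., (5.14)–(5.19)] for an arbitrary bounded
kernel `K` on `P_H⁴` (in the application `K(p,q,p',q') = [e p+e q = e p'+e q'] W(e p'-e p) γ_pγ_qγ_{p'}γ_{q'}`).

## References

* [BastiCenatiempoSchlein2021] G. Basti, S. Cenatiempo, B. Schlein, Forum Math. Sigma 9 (2021) e74,
  arXiv:2101.06222: §5.3, (5.12)–(5.14), (5.19).
-/

noncomputable section

namespace Literature.MathematicalPhysics.QuantumManyBody.BoseGas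

open Complex MvPolynomial Finset
open scoped ComplexConjugate BigOperators

namespace Fock

variable {ι : Type*} [DecidableEq ι] [LinearOrder ι] {e : ι → Momentum} {PH PS : Finset ι}

/-! ## 0. Structure lemmas on admissible sets of triples (diagonal pairing, one differing triple,
hard-slot reindexing): sequel material of `CubicTrialVector.lean` -/

/-! ### The diagonal case of the pairing: `S = S'` forces `{x, y} = {x', y'}` -/

section Diagonal

variable {T : Type*}

omit [DecidableEq ι] [LinearOrder ι] in
/-- `δ_{x'} + δ_{y'} = δ_x + δ_y` with `x ≠ y` forces `{x', y'} = {x, y}`. [folklore] -/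
theorem single_add_single_eq_iff {x y x' y' : ι} (hxy : x ≠ y)
    (h : Finsupp.single x' 1 + Finsupp.single y' 1 = (Finsupp.single x 1 + Finsupp.single y 1 : ι →₀ ℕ)) :
    (x' = x ∧ y' = y) ∨ (x' = y ∧ y' = x) := by
  classical
  have hx := congrArg (fun f => f x) h
  have hy := congrArg (fun f => f y) h
  simp only [Finsupp.coe_add, Pi.add_apply, Finsupp.single_apply, if_true, if_neg hxy, if_neg (Ne.symm hxy)] at hx hy
  by_cases h1 : x' = x
  · left
    refine ⟨h1, ?_⟩
    rw [if_neg (show x' ≠ y from h1 ▸ hxy)] at hy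
    by_contra h2
    rw [if_neg h2] at hy
    simp at hy
  · right
    rw [if_neg h1] at hx
    by_cases h2 : y' = x
    · refine ⟨?_, h2⟩
      rw [if_neg (show y' ≠ y from h2 ▸ hxy)] at hy
      by_contra h3
      rw [if_neg h3] at hy
      simp at hy
    · rw [if_neg h2] at hx
      simp at hx

variable {u a b : T → ι}

omit [DecidableEq ι] [LinearOrder ι] in
/-- **Diagonal pairing**: if `d(S) + δ_{x'} + δ_{y'} = d(S) + δ_x + δ_y` (`x ≠ y`) then
`{x', y'} = {x, y}` — on the diagonal `S = S'` the two annihilated pairs coincide.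
[cite: BastiCenatiempoSchlein2021, §5.3 (case `r = 0` / `p = q` of `𝒱_N^{(H)}`)] -/
theorem pair_eq_of_setOcc_add_eq (S : Finset T) {x y x' y' : ι} (hxy : x ≠ y)
    (h : setOcc u a b S + (Finsupp.single x' 1 + Finsupp.single y' 1) =
      setOcc u a b S + (Finsupp.single x 1 + Finsupp.single y 1)) :
    (x' = x ∧ y' = y) ∨ (x' = y ∧ y' = x) :=
  single_add_single_eq_iff hxy (add_left_cancel h)

end Diagonal

/-! ### The off-diagonal case with one differing triple (`V₁`) -/

section OneTriple

omit [DecidableEq ι] in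
/-- Two oriented triples with the same soft slot sharing a hard mode are equal (injective labels).
[cite: BastiCenatiempoSchlein2021, §5.3] -/
theorem Triple.eq_of_b_eq_of_hard_mem (he : Function.Injective e) {τ τ' : Triple e PH PS}
    (hb : τ.b = τ'.b) {p : ι} (hp : p = τ.u ∨ p = τ.a) (hp' : p = τ'.u ∨ p = τ'.a) : τ = τ' := by
  obtain ⟨-, -, -, hs, hlt⟩ := τ.prop
  obtain ⟨-, -, -, hs', hlt'⟩ := τ'.prop
  -- `e u + e a = -e b` in both orders, for both triples
  have hua : e τ.u + e τ.a = -e τ.b := eq_neg_of_add_eq_zero_left hs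
  have hau : e τ.a + e τ.u = -e τ.b := by rw [add_comm]; exact hua
  have hua' : e τ'.u + e τ'.a = -e τ.b := by rw [hb]; exact eq_neg_of_add_eq_zero_left hs'
  have hau' : e τ'.a + e τ'.u = -e τ.b := by rw [add_comm]; exact hua'
  -- the complementary hard momenta agree
  have key : ∀ {m m' : ι}, e m + e p = -e τ.b → e m' + e p = -e τ.b → m = m' := by
    intro m m' h1 h2
    apply he
    exact add_right_cancel (h1.trans h2.symm)
  rcases hp with rfl | rfl <;> rcases hp' with h' | h'
  · -- u = u'
    have ha : τ.a = τ'.a := key hau (by rw [h']; exact hau')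
    exact Triple.ext' h' ha hb
  · -- u = a' : then a = u', contradicting the orientations
    have ha : τ.a = τ'.u := key hau (by rw [h']; exact hua')
    exfalso
    rw [h'] at hlt; rw [← ha] at hlt'
    exact lt_asymm hlt hlt'
  · have hu : τ.u = τ'.a := key hua (by rw [h']; exact hau')
    exfalso
    rw [h'] at hlt; rw [← hu] at hlt'
    exact lt_asymm hlt hlt'
  · have hu : τ.u = τ'.u := key hua (by rw [h']; exact hua')
    exact Triple.ext' hu h' hb

omit [DecidableEq ι] in
/-- Occupation-related admissible sets have the same size (`3|S| + 2 = 3|S'| + 2`). [folklore] -/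
theorem card_eq_of_setOcc_add_eq {S S' : Finset (Triple e PH PS)} {x y x' y' : ι}
    (h : setOcc Triple.u Triple.a Triple.b S + (Finsupp.single x' 1 + Finsupp.single y' 1) =
      setOcc Triple.u Triple.a Triple.b S' + (Finsupp.single x 1 + Finsupp.single y 1)) :
    S.card = S'.card := by
  have hd := congrArg Finsupp.degree h
  simp only [map_add, degree_setOcc, Finsupp.degree_single] at hd
  omega

/-- **One differing triple (`V₁`)**: if `θ(S)`, the hard `x, y, x', y'` satisfy
`d(S) + δ_{x'} + δ_{y'} = d(S') + δ_x + δ_y` and `S ∖ S' = {τ}`, then the hard slots of `τ` are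
exactly `{x, y}`: the observable created precisely the hard pair of the differing triple (and,
symmetrically, annihilated the hard pair of the differing triple of `S'`, which has the same soft
slot). [cite: BastiCenatiempoSchlein2021, §5.3 (case 1), (5.13))] -/
theorem TripleAdm.hard_slots_of_sdiff_singleton (he : Function.Injective e) (hHS : Disjoint PH PS)
    {S S' : Finset (Triple e PH PS)} (hS : TripleAdm e S) {x y x' y' : ι}
    (hx : x ∈ PH) (hy : y ∈ PH) (hx' : x' ∈ PH) (hy' : y' ∈ PH)
    (h : setOcc Triple.u Triple.a Triple.b S + (Finsupp.single x' 1 + Finsupp.single y' 1) =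
      setOcc Triple.u Triple.a Triple.b S' + (Finsupp.single x 1 + Finsupp.single y 1))
    {τ : Triple e PH PS} (hD : S \ S' = {τ}) :
    (τ.u = x ∨ τ.u = y) ∧ (τ.a = x ∨ τ.a = y) := by
  have hτ := τ.prop
  have hτD : τ ∈ S \ S' := by rw [hD]; exact Finset.mem_singleton_self τ
  obtain ⟨hτS, hτS'⟩ := Finset.mem_sdiff.1 hτD
  -- pointwise form
  have hpt : ∀ i, setOcc Triple.u Triple.a Triple.b S i + ((if x' = i then 1 else 0) + (if y' = i then 1 else 0)) =
      setOcc Triple.u Triple.a Triple.b S' i + ((if x = i then 1 else 0) + (if y = i then 1 else 0)) := by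
    intro i
    have := congrArg (fun f => f i) h
    simpa [Finsupp.add_apply, Finsupp.single_apply] using this
  have hne : ∀ {z : ι}, z ∈ PH → z ≠ τ.b := fun hz hh => Finset.disjoint_left.1 hHS hz (hh ▸ hτ.2.2.1)
  -- the soft slot of `τ` is occupied in `S'` by a triple `τ' ∉ S` with the same soft slot
  have hoB : setOcc Triple.u Triple.a Triple.b S' τ.b ≠ 0 := by
    have hb := hpt τ.b
    rw [if_neg (hne hx'), if_neg (hne hy'), if_neg (hne hx), if_neg (hne hy), add_zero, add_zero,
      add_zero] at hb
    rw [← hb]; exact (setOcc_slot_ne_zero hτS).2.2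
  obtain ⟨τ', hτ'S', hτ'b⟩ := exists_slot_of_setOcc_ne_zero hoB
  have hτ'p := τ'.prop
  have hbb : τ'.b = τ.b := by
    rcases hτ'b with hh | hh | hh
    · exact absurd (hh ▸ hτ'p.1) (Finset.disjoint_right.1 hHS hτ.2.2.1)
    · exact absurd (hh ▸ hτ'p.2.1) (Finset.disjoint_right.1 hHS hτ.2.2.1)
    · exact hh
  have hτ'S : τ' ∉ S := by
    intro hmem
    have := hS.b_injOn hmem hτS hbb
    exact hτS' (this ▸ hτ'S')
  -- `S' ∖ S = {τ'}` by counting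
  have hcard : (S' \ S).card = 1 := by
    have h1 : (S \ S').card = 1 := by rw [hD, Finset.card_singleton]
    have h2 := card_eq_of_setOcc_add_eq h
    have h3 := Finset.card_sdiff_add_card_inter S S'
    have h4 := Finset.card_sdiff_add_card_inter S' S
    rw [Finset.inter_comm] at h4
    omega
  have hD' : S' \ S = {τ'} := by
    obtain ⟨τ₀, hτ₀⟩ := Finset.card_eq_one.1 hcard
    have : τ' ∈ S' \ S := Finset.mem_sdiff.2 ⟨hτ'S', hτ'S⟩
    rw [hτ₀] at this ⊢
    rw [Finset.mem_singleton.1 this]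
  -- each hard slot of `τ` is `x` or `y`
  have hslot : ∀ p : ι, p = τ.u ∨ p = τ.a → (p = x ∨ p = y) := by
    intro p hp
    have hpH : p ∈ PH := by rcases hp with rfl | rfl; exacts [hτ.1, hτ.2.1]
    have hpS : setOcc Triple.u Triple.a Triple.b S p ≠ 0 := by
      rcases hp with rfl | rfl
      · exact (setOcc_slot_ne_zero hτS).1
      · exact (setOcc_slot_ne_zero hτS).2.1
    by_contra hno
    push Not at hno
    have hpe := hpt p
    rw [if_neg (Ne.symm hno.1), if_neg (Ne.symm hno.2), add_zero, add_zero] at hpe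
    have hpS' : setOcc Triple.u Triple.a Triple.b S' p ≠ 0 := by
      intro h0; rw [h0] at hpe; omega
    obtain ⟨τ₁, hτ₁S', hτ₁p⟩ := exists_slot_of_setOcc_ne_zero hpS'
    have hτ₁p' : p = τ₁.u ∨ p = τ₁.a := by
      rcases hτ₁p with hh | hh | hh
      · exact Or.inl hh.symm
      · exact Or.inr hh.symm
      · exact absurd (hh ▸ τ₁.prop.2.2.1) (Finset.disjoint_left.1 hHS hpH)
    by_cases hτ₁S : τ₁ ∈ S
    · -- two distinct triples of the admissible `S` sharing the hard mode `p`
      have hne₁ : τ ≠ τ₁ := fun hh => hτS' (hh ▸ hτ₁S')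
      exact hS.hard_ne hτS hτ₁S hne₁ (p := p) (by rcases hp with rfl | rfl <;> simp)
        (by rcases hτ₁p' with hh | hh <;> simp [hh])
    · -- `τ₁ ∈ S' ∖ S = {τ'}` shares `p` and the soft slot with `τ`
      have hτ₁ : τ₁ = τ' := by
        have : τ₁ ∈ S' \ S := Finset.mem_sdiff.2 ⟨hτ₁S', hτ₁S⟩
        rw [hD'] at this; exact Finset.mem_singleton.1 this
      subst hτ₁
      have := Triple.eq_of_b_eq_of_hard_mem he hbb.symm hp hτ₁p'
      exact hτS' (this ▸ hτ₁S')
  refine ⟨?_, ?_⟩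
  · rcases hslot τ.u (Or.inl rfl) with hh | hh
    · exact Or.inl hh
    · exact Or.inr hh
  · rcases hslot τ.a (Or.inr rfl) with hh | hh
    · exact Or.inl hh
    · exact Or.inr hh

end OneTriple

/-! ### Hard occupied modes are the hard slots of the triples (reindexing) -/

section HardSlots

/-- In an admissible set (`P_H ∩ P_S = ∅`) the number of triples having a given mode as a hard slot is
the indicator of "hard and occupied". [folklore] -/
theorem TripleAdm.card_filter_hard_slot (hHS : Disjoint PH PS) {S : Finset (Triple e PH PS)}
    (hS : TripleAdm e S) (x : ι) :
    (S.filter fun τ => τ.u = x ∨ τ.a = x).card =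
      if x ∈ PH ∧ setOcc Triple.u Triple.a Triple.b S x ≠ 0 then 1 else 0 := by
  classical
  split_ifs with h
  · obtain ⟨hxH, hocc⟩ := h
    obtain ⟨τ, hτ, hslot⟩ := exists_slot_of_setOcc_ne_zero hocc
    have hslot' : τ.u = x ∨ τ.a = x := by
      rcases hslot with hh | hh | hh
      · exact Or.inl hh
      · exact Or.inr hh
      · exact absurd (hh ▸ τ.prop.2.2.1) (Finset.disjoint_left.1 hHS hxH)
    rw [Finset.card_eq_one]
    refine ⟨τ, Finset.eq_singleton_iff_unique_mem.2 ⟨Finset.mem_filter.2 ⟨hτ, hslot'⟩, ?_⟩⟩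
    intro τ' hτ'
    obtain ⟨hτ'S, hslot''⟩ := Finset.mem_filter.1 hτ'
    by_contra hne
    exact hS.hard_ne hτ'S hτ (hne) (p := x) (by rcases hslot'' with hh | hh <;> simp [hh])
      (by rcases hslot' with hh | hh <;> simp [hh])
  · rw [Finset.card_eq_zero, Finset.filter_eq_empty_iff]
    intro τ hτ hslot
    apply h
    refine ⟨?_, ?_⟩
    · rcases hslot with hh | hh
      · exact hh ▸ τ.prop.1
      · exact hh ▸ τ.prop.2.1
    · rcases hslot with hh | hh
      · exact hh ▸ (setOcc_slot_ne_zero hτ).1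
      · exact hh ▸ (setOcc_slot_ne_zero hτ).2.1

/-- **Summing over hard occupied modes = summing over the hard slots of the triples**:
`∑_{x hard, occupied in S} g(x) = ∑_{τ ∈ S} (g(u_τ) + g(a_τ))` for admissible `S`.
[cite: BastiCenatiempoSchlein2021, §5.3 (contractions "with `a†_{p̃ᵢ}` … for some `p̃_ℓ ∈ {-r̃_ℓ, r̃_ℓ + v_ℓ}`")] -/
theorem TripleAdm.sum_ite_hard_occupied [Fintype ι] (hHS : Disjoint PH PS) {S : Finset (Triple e PH PS)}
    (hS : TripleAdm e S) (g : ι → ℂ) :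
    ∑ x, (if x ∈ PH ∧ setOcc Triple.u Triple.a Triple.b S x ≠ 0 then g x else 0) =
      ∑ τ ∈ S, (g τ.u + g τ.a) := by
  classical
  have h1 : ∀ x, (if x ∈ PH ∧ setOcc Triple.u Triple.a Triple.b S x ≠ 0 then g x else 0) =
      ((S.filter fun τ => τ.u = x ∨ τ.a = x).card : ℂ) * g x := by
    intro x
    rw [hS.card_filter_hard_slot hHS x]
    split_ifs <;> simp
  simp only [h1, Finset.card_eq_sum_ones, Nat.cast_sum, Finset.sum_mul, Finset.sum_filter]
  rw [Finset.sum_comm]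
  refine Finset.sum_congr rfl fun τ _ => ?_
  have hua : τ.u ≠ τ.a := ne_of_lt τ.prop.2.2.2.2
  have hite : ∀ x, ((if τ.u = x ∨ τ.a = x then 1 else 0 : ℕ) : ℂ) * g x =
      if τ.u = x ∨ τ.a = x then g x else 0 := by
    intro x; split_ifs <;> simp
  simp only [hite]
  have hfil : Finset.univ.filter (fun x => τ.u = x ∨ τ.a = x) = {τ.u, τ.a} := by
    ext x; simp [eq_comm]
  rw [← Finset.sum_filter, hfil, Finset.sum_pair hua]

/-- **Ordered pairs of distinct hard occupied modes = same-triple pairs + cross-triple pairs**: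
`∑_{x ≠ y hard, occupied} f(x,y) = ∑_{τ∈S} (f(u,a) + f(a,u)) + ∑_{τ₁ ≠ τ₂ ∈ S} ∑_{p ∈ {u₁,a₁}, q ∈ {u₂,a₂}} f(p,q)`
— the case distinction 1)/2) of [BastiCenatiempoSchlein2021, §5.3] for the two annihilated modes.
[cite: BastiCenatiempoSchlein2021, §5.3 (cases 1) and 2))] -/
theorem TripleAdm.sum_sum_ite_hard_occupied_ne [Fintype ι] (hHS : Disjoint PH PS)
    {S : Finset (Triple e PH PS)} (hS : TripleAdm e S) (f : ι → ι → ℂ) :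
    ∑ x, ∑ y, (if (x ∈ PH ∧ setOcc Triple.u Triple.a Triple.b S x ≠ 0) ∧
        (y ∈ PH ∧ setOcc Triple.u Triple.a Triple.b S y ≠ 0) ∧ x ≠ y then f x y else 0) =
      ∑ τ ∈ S, (f τ.u τ.a + f τ.a τ.u) +
        ∑ τ₁ ∈ S, ∑ τ₂ ∈ S.erase τ₁, (f τ₁.u τ₂.u + f τ₁.u τ₂.a + f τ₁.a τ₂.u + f τ₁.a τ₂.a) := by
  classical
  -- inner sum via the slot reindexing
  have hin : ∀ x, ∑ y, (if (x ∈ PH ∧ setOcc Triple.u Triple.a Triple.b S x ≠ 0) ∧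
      (y ∈ PH ∧ setOcc Triple.u Triple.a Triple.b S y ≠ 0) ∧ x ≠ y then f x y else 0) =
      if x ∈ PH ∧ setOcc Triple.u Triple.a Triple.b S x ≠ 0 then
        ∑ τ₂ ∈ S, ((if x ≠ τ₂.u then f x τ₂.u else 0) + (if x ≠ τ₂.a then f x τ₂.a else 0)) else 0 := by
    intro x
    split_ifs with hx
    · rw [← hS.sum_ite_hard_occupied hHS (fun y => if x ≠ y then f x y else 0)]
      refine Finset.sum_congr rfl fun y _ => ?_
      by_cases hy : y ∈ PH ∧ setOcc Triple.u Triple.a Triple.b S y ≠ 0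
      · by_cases hxy : x ≠ y
        · rw [if_pos ⟨hx, hy, hxy⟩, if_pos hy, if_pos hxy]
        · rw [if_neg (fun h => hxy h.2.2), if_pos hy, if_neg hxy]
      · rw [if_neg (fun h => hy h.2.1), if_neg hy]
    · exact Finset.sum_eq_zero fun y _ => if_neg fun h => hx h.1
  simp only [hin]
  rw [hS.sum_ite_hard_occupied hHS]
  rw [← Finset.sum_add_distrib]
  refine Finset.sum_congr rfl fun τ₁ hτ₁ => ?_
  have hua : τ₁.u ≠ τ₁.a := ne_of_lt τ₁.prop.2.2.2.2
  rw [← Finset.add_sum_erase S _ hτ₁, ← Finset.add_sum_erase S _ hτ₁]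
  simp only [ne_eq, not_true_eq_false, if_false, hua, Ne.symm hua, not_false_eq_true, if_true, zero_add,
    add_zero]
  -- cross terms: all four slots differ from the slots of `τ₁`
  have hcross : ∀ τ₂ ∈ S.erase τ₁, ∀ p, (p = τ₁.u ∨ p = τ₁.a) →
      ((if ¬p = τ₂.u then f p τ₂.u else 0) + (if ¬p = τ₂.a then f p τ₂.a else 0)) = f p τ₂.u + f p τ₂.a := by
    intro τ₂ hτ₂ p hp
    obtain ⟨hne, hτ₂S⟩ := Finset.mem_erase.1 hτ₂
    have h := fun (q : ι) (hq : q ∈ ({τ₂.u, τ₂.a} : Finset ι)) (hpq : p = q) =>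
      hS.hard_ne hτ₁ hτ₂S (Ne.symm hne) (p := p) (by rcases hp with rfl | rfl <;> simp) (hpq ▸ hq)
    rw [if_pos (fun hh => h τ₂.u (by simp) hh), if_pos (fun hh => h τ₂.a (by simp) hh)]
  rw [Finset.sum_congr rfl fun τ₂ hτ₂ => hcross τ₂ hτ₂ τ₁.u (Or.inl rfl),
    Finset.sum_congr rfl fun τ₂ hτ₂ => hcross τ₂ hτ₂ τ₁.a (Or.inr rfl)]
  have hsplit : ∑ τ₂ ∈ S.erase τ₁, (f τ₁.u τ₂.u + f τ₁.u τ₂.a + f τ₁.a τ₂.u + f τ₁.a τ₂.a) =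
      ∑ τ₂ ∈ S.erase τ₁, (f τ₁.u τ₂.u + f τ₁.u τ₂.a) + ∑ τ₂ ∈ S.erase τ₁, (f τ₁.a τ₂.u + f τ₁.a τ₂.a) := by
    rw [← Finset.sum_add_distrib]
    exact Finset.sum_congr rfl fun _ _ => by ring
  rw [hsplit]
  ring

end HardSlots

/-! ## I. Type-A contractions -/

/-- **Momentum selection**: `⟨ξ_ν, X^d⟩ = 0` unless `d` has total momentum `0`.
[cite: BastiCenatiempoSchlein2021, §5.3 (momentum conservation of the contractions)] -/
theorem fockInner_cubicVector_monomial_eq_zero_of_weight_ne [Fintype ι] (κ : Triple e PH PS → ℂ)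
    {d : ι →₀ ℕ} (hd : Finsupp.weight e d ≠ 0) (c : ℂ) :
    fockInner (cubicVector e PH PS κ) (monomial d c) = 0 :=
  fockInner_eq_zero_of_isWeightedHomogeneous_ne (isWeightedHomogeneous_cubicVector_momentum κ)
    (isWeightedHomogeneous_monomial e d c rfl) (Ne.symm hd)

/-- **Creating a triple on an admissible set and pairing with `ξ_ν`**: for `θ(R)` and an oriented
triple `τ`, `⟨ξ_ν, X^{d(R)+d(τ)}⟩ = [τ ∉ R] conj(c_{R∪τ})` (`c` already carries `[θ(R∪τ)]`): the only
admissible set with occupation `d(R) + d(τ)` is `R ∪ {τ}`.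
[cite: BastiCenatiempoSchlein2021, §5.3 (case 1))] -/
theorem fockInner_cubicVector_monomial_setOcc_add_tripleOcc [Fintype ι] (hHS : Disjoint PH PS)
    (κ : Triple e PH PS → ℂ) {R : Finset (Triple e PH PS)} (hR : TripleAdm e R) (τ : Triple e PH PS) :
    fockInner (cubicVector e PH PS κ)
        (monomial (setOcc Triple.u Triple.a Triple.b R + tripleOcc Triple.u Triple.a Triple.b τ) 1) =
      if τ ∉ R then conj (setCoeff κ (TripleAdm e) (insert τ R)) else 0 := by
  unfold cubicVector setVector
  rw [fockInner_sum_left]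
  simp only [fockInner_monomial, mul_one]
  by_cases hτ : τ ∉ R
  · rw [if_pos hτ, Finset.sum_eq_single (insert τ R)]
    · rw [if_pos (by rw [setOcc_insert hτ, add_comm])]
      by_cases hA : TripleAdm e (insert τ R)
      · rw [occFactorial_eq_one_of_le_one (hA.setOcc_le_one hHS), Nat.cast_one, one_mul]
      · rw [setCoeff_of_not hA, map_zero, mul_zero]
    · intro S _ hne
      by_cases hA : TripleAdm e S
      · rw [if_neg]
        intro h
        obtain ⟨hmem, hocc⟩ := hA.mem_of_setOcc_eq_add hHS h
        -- `S ∖ τ = R` by unique pairing, so `S = insert τ R`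
        have h1 := TripleAdm.eq_of_setOcc_eq hHS hR (hA.erase τ) hocc
        apply hne
        rw [h1, Finset.insert_erase hmem]
      · rw [setCoeff_of_not hA, map_zero, mul_zero, ite_self]
    · exact fun h => absurd (Finset.mem_univ _) h
  · rw [if_neg hτ]
    push Not at hτ
    refine Finset.sum_eq_zero fun S _ => ?_
    by_cases hA : TripleAdm e S
    · rw [if_neg]
      intro h
      obtain ⟨hmem, hocc⟩ := hA.mem_of_setOcc_eq_add hHS h
      have h1 := TripleAdm.eq_of_setOcc_eq hHS hR (hA.erase τ) hocc
      rw [h1] at hτ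
      exact Finset.notMem_erase τ S hτ
    · rw [setCoeff_of_not hA, map_zero, mul_zero, ite_self]

/-- **Annihilating the hard pair of a member triple** (Type A): for `θ(S')` (`P_H ∩ P_S = ∅`) and
`τ' ∈ S'`, `a_{a'}a_{u'} X^{d(S')} = X^{d(S'∖τ') + δ_{b'}}` (with the soft mode `b'` left behind).
[cite: BastiCenatiempoSchlein2021, §5.3 (case 1): "`A_{r_j,v_j}` fully contracted with `A†_{r_j,v_j}` for `j ≠ m`")] -/
theorem pderiv_pderiv_hardPair_monomial_setOcc (hHS : Disjoint PH PS) {S' : Finset (Triple e PH PS)}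
    (hS' : TripleAdm e S') {τ' : Triple e PH PS} (hτ' : τ' ∈ S') (c : ℂ) :
    pderiv τ'.a (pderiv τ'.u (monomial (setOcc Triple.u Triple.a Triple.b S') c)) =
      monomial (setOcc Triple.u Triple.a Triple.b (S'.erase τ') + Finsupp.single τ'.b 1) c := by
  have hp := τ'.prop
  have hua : τ'.u ≠ τ'.a := ne_of_lt hp.2.2.2.2
  have hsq := hS'.setOcc_le_one hHS
  obtain ⟨hoU, hoA, -⟩ := setOcc_slot_ne_zero hτ'
  have hU1 : setOcc Triple.u Triple.a Triple.b S' τ'.u = 1 := le_antisymm (hsq _) (Nat.one_le_iff_ne_zero.2 hoU)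
  have hA1 : setOcc Triple.u Triple.a Triple.b S' τ'.a = 1 := le_antisymm (hsq _) (Nat.one_le_iff_ne_zero.2 hoA)
  rw [pderiv_monomial, pderiv_monomial, hU1, Nat.cast_one, mul_one]
  have hA1' : (setOcc Triple.u Triple.a Triple.b S' - Finsupp.single τ'.u 1 : ι →₀ ℕ) τ'.a = 1 := by
    rw [Finsupp.tsub_apply, Finsupp.single_apply, if_neg hua, hA1, Nat.sub_zero]
  rw [hA1', Nat.cast_one, mul_one]
  congr 1
  -- `d(S') - δ_u - δ_a = d(S'∖τ') + δ_b`
  have hocc := setOcc_erase_add hτ'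
  have ht : tripleOcc Triple.u Triple.a Triple.b τ' =
      Finsupp.single τ'.u 1 + Finsupp.single τ'.a 1 + Finsupp.single τ'.b 1 := rfl
  rw [← hocc, ht]
  have hre : setOcc Triple.u Triple.a Triple.b (S'.erase τ') +
      (Finsupp.single τ'.u 1 + Finsupp.single τ'.a 1 + Finsupp.single τ'.b 1) =
      setOcc Triple.u Triple.a Triple.b (S'.erase τ') + Finsupp.single τ'.b 1 + Finsupp.single τ'.a 1 +
        Finsupp.single τ'.u 1 := by abel
  rw [hre, add_tsub_cancel_right, add_tsub_cancel_right]

/-- **No double occupation**: `⟨ξ_ν, X^d⟩ = 0` if some mode is occupied twice in `d`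
(admissible occupations are squarefree). [cite: BastiCenatiempoSchlein2021, §5 (`p_i ≠ p_j`: "at most one particle with given momentum")] -/
theorem fockInner_cubicVector_monomial_eq_zero_of_two_le [Fintype ι] (hHS : Disjoint PH PS)
    (κ : Triple e PH PS → ℂ) {d : ι →₀ ℕ} {i : ι} (hi : 2 ≤ d i) (c : ℂ) :
    fockInner (cubicVector e PH PS κ) (monomial d c) = 0 := by
  unfold cubicVector setVector
  rw [fockInner_sum_left]
  refine Finset.sum_eq_zero fun S _ => ?_
  rw [fockInner_monomial]
  by_cases hA : TripleAdm e S
  · rw [if_neg]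
    intro h
    have := hA.setOcc_le_one hHS i
    rw [h] at this
    omega
  · rw [setCoeff_of_not hA, map_zero, zero_mul, mul_zero, ite_self]

/-- **Type-A pairing, ordered hard pair**: for `θ(R)`, a soft mode `b ∈ P_S` and hard `x < y` with
`e x + e y + e b = 0` (so that `τ = (x, y, b)` is an oriented triple),
`⟨ξ_ν, X_xX_yX^{d(R)+δ_b}⟩ = [τ ∉ R] conj(c_{R∪τ})`. [cite: BastiCenatiempoSchlein2021, §5.3 (5.13)] -/
theorem fockInner_cubicVector_X_mul_X_mul_monomial [Fintype ι] (hHS : Disjoint PH PS)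
    (κ : Triple e PH PS → ℂ) {R : Finset (Triple e PH PS)} (hR : TripleAdm e R)
    {x y b : ι} (hx : x ∈ PH) (hy : y ∈ PH) (hb : b ∈ PS) (hsum : e x + e y + e b = 0) (hlt : x < y) :
    fockInner (cubicVector e PH PS κ)
        (X x * X y * monomial (setOcc Triple.u Triple.a Triple.b R + Finsupp.single b 1) 1) =
      let τ : Triple e PH PS := ⟨(x, y, b), hx, hy, hb, hsum, hlt⟩
      if τ ∉ R then conj (setCoeff κ (TripleAdm e) (insert τ R)) else 0 := by
  have hd : Finsupp.single x 1 + Finsupp.single y 1 + (setOcc Triple.u Triple.a Triple.b R + Finsupp.single b 1) =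
      setOcc Triple.u Triple.a Triple.b R +
        tripleOcc Triple.u Triple.a Triple.b (⟨(x, y, b), hx, hy, hb, hsum, hlt⟩ : Triple e PH PS) := by
    show Finsupp.single x 1 + Finsupp.single y 1 + (setOcc Triple.u Triple.a Triple.b R + Finsupp.single b 1) =
      setOcc Triple.u Triple.a Triple.b R + (Finsupp.single x 1 + Finsupp.single y 1 + Finsupp.single b 1)
    abel
  have hmon : (X x * X y * monomial (setOcc Triple.u Triple.a Triple.b R + Finsupp.single b 1) 1 :
      MvPolynomial ι ℂ) = monomial (setOcc Triple.u Triple.a Triple.b R +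
        tripleOcc Triple.u Triple.a Triple.b (⟨(x, y, b), hx, hy, hb, hsum, hlt⟩ : Triple e PH PS)) 1 := by
    rw [X, X, monomial_mul, monomial_mul, one_mul, one_mul, hd]
  rw [hmon]
  exact fockInner_cubicVector_monomial_setOcc_add_tripleOcc hHS κ hR _

/-- **Type-A pairing vanishes off the momentum shell**: for any `R`, modes `x, y, b` with
`e x + e y + e b ≠ 0`, `⟨ξ_ν, X_xX_yX^{d(R)+δ_b}⟩ = 0`. [cite: BastiCenatiempoSchlein2021, §5.3] -/
theorem fockInner_cubicVector_X_mul_X_mul_monomial_eq_zero [Fintype ι]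
    (κ : Triple e PH PS → ℂ) (R : Finset (Triple e PH PS)) {x y b : ι} (hsum : e x + e y + e b ≠ 0) :
    fockInner (cubicVector e PH PS κ)
        (X x * X y * monomial (setOcc Triple.u Triple.a Triple.b R + Finsupp.single b 1) 1) = 0 := by
  have hmon : (X x * X y * monomial (setOcc Triple.u Triple.a Triple.b R + Finsupp.single b 1) 1 :
      MvPolynomial ι ℂ) = monomial (Finsupp.single x 1 + Finsupp.single y 1 +
        (setOcc Triple.u Triple.a Triple.b R + Finsupp.single b 1)) 1 := by
    rw [X, X, monomial_mul, monomial_mul, one_mul, one_mul]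
  rw [hmon]
  refine fockInner_cubicVector_monomial_eq_zero_of_weight_ne κ ?_ 1
  have h0 := weight_setOcc_eq_zero (u := Triple.u) (a := Triple.a) (b := Triple.b) e
    (fun τ : Triple e PH PS => τ.prop.2.2.2.1) R
  simp only [map_add, Finsupp.weight_single, one_smul, h0, zero_add]
  intro h
  apply hsum
  simpa [add_assoc] using h

/-- **Type-A pairing vanishes for a repeated hard mode**: `⟨ξ_ν, X_xX_xX^{d}⟩ = 0`.
[cite: BastiCenatiempoSchlein2021, §5.3] -/
theorem fockInner_cubicVector_X_mul_X_self_mul_monomial [Fintype ι] (hHS : Disjoint PH PS)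
    (κ : Triple e PH PS → ℂ) (x : ι) (d : ι →₀ ℕ) :
    fockInner (cubicVector e PH PS κ) (X x * X x * monomial d 1) = 0 := by
  have hmon : (X x * X x * monomial d 1 : MvPolynomial ι ℂ) =
      monomial (Finsupp.single x 1 + Finsupp.single x 1 + d) 1 := by
    rw [X, monomial_mul, monomial_mul, one_mul, one_mul]
  rw [hmon]
  refine fockInner_cubicVector_monomial_eq_zero_of_two_le hHS κ (i := x) ?_ 1
  simp only [Finsupp.coe_add, Pi.add_apply, Finsupp.single_eq_same]
  omega

/-! ### Summing the Type-A pairing over the created hard pair -/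

/-- **Type-A pairing summed over the created hard pair**: for `θ(R)` and a soft `b ∈ P_S`,
`∑_{x,y ∈ P_H} K(x,y) ⟨a_ya_xξ_ν, X^{d(R)+δ_b}⟩ = ∑_{τ : b_τ = b, τ ∉ R} (K(u,a) + K(a,u)) conj(c_{R∪τ})`:
the created pair must complete `b` to an oriented triple absent from `R` (pairs off the momentum
shell, repeated modes and non-hard modes contribute nothing).
[cite: BastiCenatiempoSchlein2021, §5.3 (5.13) ("the choice of `p` and `p+r` also determines `q` and `q+r`")] -/
theorem sum_sum_mul_fockInner_pderiv_pderiv_cubicVector_monomial [Fintype ι] (hHS : Disjoint PH PS)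
    (κ : Triple e PH PS → ℂ) {R : Finset (Triple e PH PS)} (hR : TripleAdm e R) {b : ι} (hb : b ∈ PS)
    (K : ι → ι → ℂ) :
    ∑ x ∈ PH, ∑ y ∈ PH, K x y * fockInner (pderiv y (pderiv x (cubicVector e PH PS κ)))
        (monomial (setOcc Triple.u Triple.a Triple.b R + Finsupp.single b 1) 1) =
      ∑ τ ∈ (Finset.univ : Finset (Triple e PH PS)).filter (fun τ => τ.b = b),
        if τ ∉ R then (K τ.u τ.a + K τ.a τ.u) * conj (setCoeff κ (TripleAdm e) (insert τ R)) else 0 := by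
  classical
  set m : MvPolynomial ι ℂ := monomial (setOcc Triple.u Triple.a Triple.b R + Finsupp.single b 1) 1 with hm
  set P : ι → ι → ℂ := fun x y => fockInner (cubicVector e PH PS κ) (X x * X y * m) with hP
  -- move the annihilations to the right as creations
  have hadj : ∀ x y, fockInner (pderiv y (pderiv x (cubicVector e PH PS κ))) m = P x y := by
    intro x y
    simp only [hP]
    rw [mul_assoc, fockInner_X_mul_right, fockInner_X_mul_right]
  simp only [hadj]
  have hPsymm : ∀ x y, P x y = P y x := by intro x y; simp only [hP]; rw [mul_comm (X x)]
  -- values on triples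
  have hPτ : ∀ τ : Triple e PH PS, τ.b = b →
      P τ.u τ.a = if τ ∉ R then conj (setCoeff κ (TripleAdm e) (insert τ R)) else 0 := by
    intro τ hτ
    have hp := τ.prop
    have h := fockInner_cubicVector_X_mul_X_mul_monomial hHS κ hR hp.1 hp.2.1 hb (hτ ▸ hp.2.2.2.1) hp.2.2.2.2
    have hτeq : (⟨(τ.u, τ.a, b), hp.1, hp.2.1, hb, hτ ▸ hp.2.2.2.1, hp.2.2.2.2⟩ : Triple e PH PS) = τ :=
      Triple.ext' rfl rfl hτ.symm
    simp only [hτeq] at h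
    simp only [hP, hm]
    exact h
  -- the two images of the triples with soft slot `b`
  set Tb := (Finset.univ : Finset (Triple e PH PS)).filter (fun τ => τ.b = b) with hTb
  set I₁ := Tb.image (fun τ => (τ.u, τ.a)) with hI₁
  set I₂ := Tb.image (fun τ => (τ.a, τ.u)) with hI₂
  have hinj₁ : Set.InjOn (fun τ : Triple e PH PS => (τ.u, τ.a)) Tb := by
    intro τ hτ τ' hτ' h
    simp only [hTb, Finset.coe_filter, Finset.mem_univ, true_and, Set.mem_setOf_eq] at hτ hτ'
    simp only [Prod.mk.injEq] at h
    exact Triple.ext' h.1 h.2 (hτ.trans hτ'.symm)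
  have hinj₂ : Set.InjOn (fun τ : Triple e PH PS => (τ.a, τ.u)) Tb := by
    intro τ hτ τ' hτ' h
    simp only [hTb, Finset.coe_filter, Finset.mem_univ, true_and, Set.mem_setOf_eq] at hτ hτ'
    simp only [Prod.mk.injEq] at h
    exact Triple.ext' h.2 h.1 (hτ.trans hτ'.symm)
  have hdisj : Disjoint I₁ I₂ := by
    rw [Finset.disjoint_left]
    intro xy h1 h2
    simp only [hI₁, hI₂, Finset.mem_image] at h1 h2
    obtain ⟨τ, -, rfl⟩ := h1
    obtain ⟨τ', -, h⟩ := h2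
    simp only [Prod.mk.injEq] at h
    have := τ.prop.2.2.2.2; have := τ'.prop.2.2.2.2
    rw [h.1, h.2] at *
    exact lt_asymm ‹τ.u < τ.a› ‹τ.a < τ.u›
  have hsub : I₁ ∪ I₂ ⊆ PH ×ˢ PH := by
    intro xy hxy
    rcases Finset.mem_union.1 hxy with h | h
    · obtain ⟨τ, -, rfl⟩ := Finset.mem_image.1 h
      exact Finset.mem_product.2 ⟨τ.prop.1, τ.prop.2.1⟩
    · obtain ⟨τ, -, rfl⟩ := Finset.mem_image.1 h
      exact Finset.mem_product.2 ⟨τ.prop.2.1, τ.prop.1⟩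
  -- outside the images the pairing vanishes
  have hzero : ∀ xy ∈ PH ×ˢ PH, xy ∉ I₁ ∪ I₂ → K xy.1 xy.2 * P xy.1 xy.2 = 0 := by
    rintro ⟨x, y⟩ hxy hnot
    obtain ⟨hx, hy⟩ := Finset.mem_product.1 hxy
    simp only
    by_cases hmom : e x + e y + e b = 0
    · rcases lt_trichotomy x y with hlt | heq | hgt
      · exfalso; apply hnot
        refine Finset.mem_union_left _ (Finset.mem_image.2 ⟨⟨(x, y, b), hx, hy, hb, hmom, hlt⟩, ?_, rfl⟩)
        simp [hTb, Triple.b]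
      · subst heq
        simp only [hP]; rw [fockInner_cubicVector_X_mul_X_self_mul_monomial hHS, mul_zero]
      · exfalso; apply hnot
        have hmom' : e y + e x + e b = 0 := by rw [add_comm (e y)]; exact hmom
        refine Finset.mem_union_right _ (Finset.mem_image.2 ⟨⟨(y, x, b), hy, hx, hb, hmom', hgt⟩, ?_, rfl⟩)
        simp [hTb, Triple.b]
    · simp only [hP, hm]; rw [fockInner_cubicVector_X_mul_X_mul_monomial_eq_zero κ R hmom, mul_zero]
  rw [← Finset.sum_product', ← Finset.sum_subset hsub (fun xy hxy hnot => hzero xy hxy hnot),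
    Finset.sum_union hdisj, Finset.sum_image hinj₁, Finset.sum_image hinj₂, ← Finset.sum_add_distrib]
  refine Finset.sum_congr rfl fun τ hτ => ?_
  have hτb : τ.b = b := by simpa [hTb] using hτ
  simp only
  rw [hPsymm τ.a τ.u, hPτ τ hτb]
  split_ifs <;> ring

/-! ### Resummation of the Type-A contractions over `(S', τ') ↦ S' ∖ τ'` and freeing -/

omit [LinearOrder ι] in
/-- The coefficient of `R ∪ {τ}` (`τ ∉ R`) factorises: `c_{R∪τ} = [θ(R∪τ)] κ_τ c_R` (heredity of `θ`).
[cite: BastiCenatiempoSchlein2021, (2.13)–(2.14)] -/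
theorem setCoeff_insert_eq [LinearOrder ι] (κ : Triple e PH PS → ℂ) {R : Finset (Triple e PH PS)}
    {τ : Triple e PH PS} (hτ : τ ∉ R) :
    setCoeff κ (TripleAdm e) (insert τ R) =
      if TripleAdm e (insert τ R) then κ τ * setCoeff κ (TripleAdm e) R else 0 := by
  by_cases hA : TripleAdm e (insert τ R)
  · rw [if_pos hA, setCoeff_of hA, setCoeff_of (hA.mono (Finset.subset_insert τ R)), Finset.prod_insert hτ]
  · rw [if_neg hA, setCoeff_of_not hA]

omit [DecidableEq ι] [LinearOrder ι] in
/-- Reindexing `(S', τ' ∈ S') ↦ (S' ∖ τ', τ')`: `∑_{S'} ∑_{τ'∈S'} F(S', τ', S'∖τ') = ∑_R ∑_{τ'∉R} F(R∪τ', τ', R)`.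
[folklore] -/
theorem sum_sum_mem_eq_sum_sum_notMem {T : Type*} [Fintype T] [DecidableEq T] {M : Type*} [AddCommMonoid M]
    (F : Finset T → T → Finset T → M) :
    ∑ S : Finset T, ∑ τ ∈ S, F S τ (S.erase τ) =
      ∑ R : Finset T, ∑ τ : T, (if τ ∉ R then F (insert τ R) τ R else 0) := by
  calc ∑ S : Finset T, ∑ τ ∈ S, F S τ (S.erase τ)
      = ∑ S : Finset T, ∑ τ : T, (if τ ∈ S then F S τ (S.erase τ) else 0) := by
        refine Finset.sum_congr rfl fun S _ => ?_
        rw [← Finset.sum_filter, Finset.filter_mem_eq_inter, Finset.univ_inter]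
    _ = ∑ τ : T, ∑ S : Finset T, (if τ ∈ S then F S τ (S.erase τ) else 0) := Finset.sum_comm
    _ = ∑ τ : T, ∑ R : Finset T, (if τ ∉ R then F (insert τ R) τ R else 0) := by
        refine Finset.sum_congr rfl fun τ _ => ?_
        rw [← Finset.sum_filter, ← Finset.sum_filter]
        refine Finset.sum_bij' (fun S _ => S.erase τ) (fun R _ => insert τ R) ?_ ?_ ?_ ?_ ?_
        · intro S hS
          simp only [Finset.mem_filter, Finset.mem_univ, true_and] at hS ⊢
          exact Finset.notMem_erase τ S
        · intro R hR
          simp only [Finset.mem_filter, Finset.mem_univ, true_and] at hR ⊢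
          exact Finset.mem_insert_self τ R
        · intro S hS
          simp only [Finset.mem_filter, Finset.mem_univ, true_and] at hS
          exact Finset.insert_erase hS
        · intro R hR
          simp only [Finset.mem_filter, Finset.mem_univ, true_and] at hR
          exact Finset.erase_insert hR
        · intro S hS
          simp only [Finset.mem_filter, Finset.mem_univ, true_and] at hS
          rw [Finset.insert_erase hS]
    _ = _ := Finset.sum_comm

/-- **The Type-A contractions, resummed**: with `K̃(τ, τ')` the observable coefficient summed over
the orderings of the created pair (of `τ`) and of the annihilated pair (of `τ'`),
`∑_{S'} c_{S'} ∑_{τ'∈S'} ∑_{τ : b_τ = b_{τ'}, τ ∉ S'∖τ'} K̃(τ,τ') conj(c_{(S'∖τ')∪τ})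
 = ∑_R |c_R|² ∑_{τ, τ' ∉ R, b_τ = b_{τ'}, θ(R∪τ), θ(R∪τ')} κ_{τ'} conj(κ_τ) K̃(τ,τ')`
— all triples but the contracted one are paired identically (`V₁` before freeing, including the
same-triple diagonal `τ = τ'`). [cite: BastiCenatiempoSchlein2021, §5.3 (5.13)] -/
theorem sum_typeA_eq [Fintype ι] (κ : Triple e PH PS → ℂ) (Kt : Triple e PH PS → Triple e PH PS → ℂ) :
    ∑ S' : Finset (Triple e PH PS), ∑ τ' ∈ S', setCoeff κ (TripleAdm e) S' *
        ∑ τ ∈ (Finset.univ : Finset (Triple e PH PS)).filter (fun τ => τ.b = τ'.b),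
          (if τ ∉ S'.erase τ' then Kt τ τ' * conj (setCoeff κ (TripleAdm e) (insert τ (S'.erase τ'))) else 0) =
      ∑ R : Finset (Triple e PH PS), (‖setCoeff κ (TripleAdm e) R‖ ^ 2 : ℂ) *
        ∑ τ' : Triple e PH PS, ∑ τ : Triple e PH PS,
          (if τ' ∉ R ∧ τ ∉ R ∧ τ.b = τ'.b ∧ TripleAdm e (insert τ' R) ∧ TripleAdm e (insert τ R) then
            κ τ' * conj (κ τ) * Kt τ τ' else 0) := by
  classical
  rw [sum_sum_mem_eq_sum_sum_notMem (fun S' τ' R => setCoeff κ (TripleAdm e) S' *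
    ∑ τ ∈ (Finset.univ : Finset (Triple e PH PS)).filter (fun τ => τ.b = τ'.b),
      (if τ ∉ R then Kt τ τ' * conj (setCoeff κ (TripleAdm e) (insert τ R)) else 0))]
  refine Finset.sum_congr rfl fun R _ => ?_
  rw [Finset.mul_sum]
  refine Finset.sum_congr rfl fun τ' _ => ?_
  rw [Finset.mul_sum]
  by_cases hτ' : τ' ∈ R
  · have h0 : ¬ (τ' ∉ R) := not_not.2 hτ'
    simp [h0]
  · rw [if_pos hτ', Finset.sum_filter, Finset.mul_sum]
    refine Finset.sum_congr rfl fun τ _ => ?_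
    by_cases hcond : (τ' ∉ R ∧ τ ∉ R ∧ τ.b = τ'.b ∧ TripleAdm e (insert τ' R) ∧ TripleAdm e (insert τ R))
    · obtain ⟨-, hτ, hb, hA', hA⟩ := hcond
      rw [if_pos (show τ' ∉ R ∧ τ ∉ R ∧ τ.b = τ'.b ∧ TripleAdm e (insert τ' R) ∧ TripleAdm e (insert τ R) from
        ⟨hτ', hτ, hb, hA', hA⟩), if_pos hb, if_pos hτ, setCoeff_insert_eq κ hτ', setCoeff_insert_eq κ hτ,
        if_pos hA', if_pos hA, map_mul]
      rw [← Complex.mul_conj' (setCoeff κ (TripleAdm e) R)]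
      ring
    · rw [if_neg hcond, mul_zero]
      by_cases hb : τ.b = τ'.b
      · by_cases hτ : τ ∈ R
        · have h0 : ¬ (τ ∉ R) := not_not.2 hτ
          simp [h0]
        · rw [if_pos hb, if_pos hτ, setCoeff_insert_eq κ hτ', setCoeff_insert_eq κ hτ]
          by_cases hA' : TripleAdm e (insert τ' R)
          · have hA : ¬ TripleAdm e (insert τ R) := fun hA => hcond ⟨hτ', hτ, hb, hA', hA⟩
            rw [if_neg hA, map_zero, mul_zero, mul_zero]
          · rw [if_neg hA', zero_mul]
      · simp [hb]

/-- **Freeing the two triples** (pairwise version of `θ_m = 1 + [θ_m - 1]`): with the pairwise cutoff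
defect `D₂(τ',τ) = ∑_{R : τ' ∈ R ∨ τ ∈ R ∨ ¬θ(R∪τ') ∨ ¬θ(R∪τ)} |c_R|²`,
`∑_R |c_R|² ∑_{τ',τ} [conds] κ_{τ'} conj(κ_τ) K̃ = ∑_{τ',τ : b_τ = b_{τ'}} κ_{τ'} conj(κ_τ) K̃ (∑_R |c_R|² - D₂(τ',τ))`
— the main term `V₁` of (5.14) times `‖ξ_ν‖²` plus the cutoff error.
[cite: BastiCenatiempoSchlein2021, §5.3 (5.13)–(5.14)] -/
theorem sum_typeA_freed [Fintype ι] (κ : Triple e PH PS → ℂ) (Kt : Triple e PH PS → Triple e PH PS → ℂ) :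
    ∑ R : Finset (Triple e PH PS), (‖setCoeff κ (TripleAdm e) R‖ ^ 2 : ℂ) *
        ∑ τ' : Triple e PH PS, ∑ τ : Triple e PH PS,
          (if τ' ∉ R ∧ τ ∉ R ∧ τ.b = τ'.b ∧ TripleAdm e (insert τ' R) ∧ TripleAdm e (insert τ R) then
            κ τ' * conj (κ τ) * Kt τ τ' else 0) =
      ∑ τ' : Triple e PH PS, ∑ τ : Triple e PH PS, (if τ.b = τ'.b then
        κ τ' * conj (κ τ) * Kt τ τ' *
          (((∑ R : Finset (Triple e PH PS), ‖setCoeff κ (TripleAdm e) R‖ ^ 2 : ℝ) : ℂ) -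
            ((∑ R : Finset (Triple e PH PS),
              (if ¬ (τ' ∉ R ∧ τ ∉ R ∧ TripleAdm e (insert τ' R) ∧ TripleAdm e (insert τ R)) then
                ‖setCoeff κ (TripleAdm e) R‖ ^ 2 else 0) : ℝ) : ℂ)) else 0) := by
  classical
  -- swap the sums
  simp only [Finset.mul_sum]
  rw [Finset.sum_comm]
  refine Finset.sum_congr rfl fun τ' _ => ?_
  rw [Finset.sum_comm]
  refine Finset.sum_congr rfl fun τ _ => ?_
  by_cases hb : τ.b = τ'.b
  · rw [if_pos hb, mul_sub, Complex.ofReal_sum, Complex.ofReal_sum, Finset.mul_sum, Finset.mul_sum,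
      ← Finset.sum_sub_distrib]
    refine Finset.sum_congr rfl fun R _ => ?_
    by_cases hc : (τ' ∉ R ∧ τ ∉ R ∧ TripleAdm e (insert τ' R) ∧ TripleAdm e (insert τ R))
    · rw [if_pos (show τ' ∉ R ∧ τ ∉ R ∧ τ.b = τ'.b ∧ TripleAdm e (insert τ' R) ∧ TripleAdm e (insert τ R) from
        ⟨hc.1, hc.2.1, hb, hc.2.2.1, hc.2.2.2⟩), if_neg (not_not.2 hc)]
      push_cast
      ring
    · rw [if_neg (show ¬ (τ' ∉ R ∧ τ ∉ R ∧ τ.b = τ'.b ∧ TripleAdm e (insert τ' R) ∧ TripleAdm e (insert τ R)) from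
        fun h => hc ⟨h.1, h.2.1, h.2.2.2.1, h.2.2.2.2⟩), if_pos hc]
      push_cast
      ring
  · rw [if_neg hb]
    refine Finset.sum_eq_zero fun R _ => ?_
    rw [if_neg (show ¬ (τ' ∉ R ∧ τ ∉ R ∧ τ.b = τ'.b ∧ TripleAdm e (insert τ' R) ∧ TripleAdm e (insert τ R)) from
      fun h => hb h.2.2.1), mul_zero]

/-- **The pairwise defect is at most the sum of the two single defects**:
`D₂(τ',τ) ≤ D(τ') + D(τ)` with `D(τ) = ∑_{R : θ(R), τ ∈ R ∨ ¬θ(R∪τ)} |c_R|²` (as in the cubic freeing),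
so that the coincidence counting of [ibid., §5.2 (5.11)] bounds the `V₁` freeing error as well.
[cite: BastiCenatiempoSchlein2021, §5.3 (after (5.13): "we can now proceed as in Sect. 5.2")] -/
theorem pairDefect_le [Fintype ι] (κ : Triple e PH PS → ℂ) (τ' τ : Triple e PH PS) :
    (∑ R : Finset (Triple e PH PS),
        (if ¬ (τ' ∉ R ∧ τ ∉ R ∧ TripleAdm e (insert τ' R) ∧ TripleAdm e (insert τ R)) then
          ‖setCoeff κ (TripleAdm e) R‖ ^ 2 else 0)) ≤
      (∑ R : Finset (Triple e PH PS), (if TripleAdm e R ∧ (τ' ∈ R ∨ ¬ TripleAdm e (insert τ' R)) then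
          ‖setCoeff κ (TripleAdm e) R‖ ^ 2 else 0)) +
      ∑ R : Finset (Triple e PH PS), (if TripleAdm e R ∧ (τ ∈ R ∨ ¬ TripleAdm e (insert τ R)) then
          ‖setCoeff κ (TripleAdm e) R‖ ^ 2 else 0) := by
  rw [← Finset.sum_add_distrib]
  refine Finset.sum_le_sum fun R _ => ?_
  have h0 : 0 ≤ ‖setCoeff κ (TripleAdm e) R‖ ^ 2 := sq_nonneg _
  by_cases hA : TripleAdm e R
  · by_cases hc : (τ' ∉ R ∧ τ ∉ R ∧ TripleAdm e (insert τ' R) ∧ TripleAdm e (insert τ R))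
    · rw [if_neg (not_not.2 hc)]
      positivity
    · rw [if_pos hc]
      -- one of the two single-defect conditions holds
      have hor : (τ' ∈ R ∨ ¬ TripleAdm e (insert τ' R)) ∨ (τ ∈ R ∨ ¬ TripleAdm e (insert τ R)) := by
        by_contra hno
        push Not at hno
        exact hc ⟨hno.1.1, hno.2.1, hno.1.2, hno.2.2⟩
      rcases hor with h1 | h2
      · rw [if_pos ⟨hA, h1⟩]
        split_ifs <;> linarith
      · rw [if_pos (show TripleAdm e R ∧ (τ ∈ R ∨ ¬ TripleAdm e (insert τ R)) from ⟨hA, h2⟩)]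
        split_ifs <;> linarith
  · rw [setCoeff_of_not hA, norm_zero, zero_pow two_ne_zero]
    simp

/-- The pairwise defect is non-negative and at most `‖ξ_ν‖² = ∑_R |c_R|²`. [folklore] -/
theorem pairDefect_nonneg_le [Fintype ι] (κ : Triple e PH PS → ℂ) (τ' τ : Triple e PH PS) :
    0 ≤ (∑ R : Finset (Triple e PH PS),
        (if ¬ (τ' ∉ R ∧ τ ∉ R ∧ TripleAdm e (insert τ' R) ∧ TripleAdm e (insert τ R)) then
          ‖setCoeff κ (TripleAdm e) R‖ ^ 2 else 0)) ∧
      (∑ R : Finset (Triple e PH PS),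
        (if ¬ (τ' ∉ R ∧ τ ∉ R ∧ TripleAdm e (insert τ' R) ∧ TripleAdm e (insert τ R)) then
          ‖setCoeff κ (TripleAdm e) R‖ ^ 2 else 0)) ≤
        ∑ R : Finset (Triple e PH PS), ‖setCoeff κ (TripleAdm e) R‖ ^ 2 := by
  constructor
  · exact Finset.sum_nonneg fun R _ => by split_ifs <;> positivity
  · exact Finset.sum_le_sum fun R _ => by split_ifs <;> nlinarith [sq_nonneg ‖setCoeff κ (TripleAdm e) R‖]

/-! ### Type-B contractions (two different triples touched by the observable): structure -/

section TypeBStructure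

/-- Membership in the hard pair, as a `Finset`. [folklore] -/
theorem mem_hardPair_of {p : ι} {τ : Triple e PH PS} (hp : p = τ.u ∨ p = τ.a) :
    p ∈ ({τ.u, τ.a} : Finset ι) := by
  rcases hp with rfl | rfl <;> simp

/-- The occupation of a triple at a soft mode. [folklore] -/
theorem tripleOcc_apply_of_mem_PS (hHS : Disjoint PH PS) (τ : Triple e PH PS) {i : ι}
    (hi : i ∈ PS) : tripleOcc Triple.u Triple.a Triple.b τ i = if τ.b = i then 1 else 0 := by
  have hp := τ.prop
  have hu : τ.u ≠ i := fun h => Finset.disjoint_left.1 hHS hp.1 (h ▸ hi)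
  have ha : τ.a ≠ i := fun h => Finset.disjoint_left.1 hHS hp.2.1 (h ▸ hi)
  simp only [tripleOcc, Finsupp.coe_add, Pi.add_apply, Finsupp.single_apply, if_neg hu, if_neg ha,
    zero_add]

/-- The occupation of a triple at a hard mode is the indicator of its hard pair. [folklore] -/
theorem tripleOcc_apply_of_mem_PH (hHS : Disjoint PH PS) (τ : Triple e PH PS) {i : ι}
    (hi : i ∈ PH) :
    tripleOcc Triple.u Triple.a Triple.b τ i = if (i = τ.u ∨ i = τ.a) then 1 else 0 := by
  have hp := τ.prop
  have hb : τ.b ≠ i := fun h => Finset.disjoint_left.1 hHS hi (h.symm ▸ hp.2.2.1)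
  have hua : τ.u ≠ τ.a := ne_of_lt hp.2.2.2.2
  simp only [tripleOcc, Finsupp.coe_add, Pi.add_apply, Finsupp.single_apply, if_neg hb, add_zero]
  by_cases h1 : i = τ.u
  · subst h1; simp [Ne.symm hua]
  · by_cases h2 : i = τ.a
    · subst h2; simp [hua]
    · simp [h1, h2, Ne.symm h1, Ne.symm h2]

/-- The occupation of a set splits over `S ∖ S'` and `S ∩ S'`. [folklore] -/
theorem setOcc_eq_sdiff_add_inter (S S' : Finset (Triple e PH PS)) :
    setOcc Triple.u Triple.a Triple.b S =
      setOcc Triple.u Triple.a Triple.b (S \ S') + setOcc Triple.u Triple.a Triple.b (S ∩ S') := by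
  unfold setOcc
  conv_lhs => rw [← Finset.sdiff_union_inter S S']
  exact Finset.sum_union (Finset.disjoint_sdiff_inter S S')

/-- The occupation of a pair of triples. [folklore] -/
theorem setOcc_pair {τ τ' : Triple e PH PS} (h : τ ≠ τ') :
    setOcc Triple.u Triple.a Triple.b ({τ, τ'} : Finset (Triple e PH PS)) =
      tripleOcc Triple.u Triple.a Triple.b τ + tripleOcc Triple.u Triple.a Triple.b τ' := by
  unfold setOcc
  exact Finset.sum_pair h

/-- Occupation-related sets have symmetric differences of the same size. [folklore] -/
theorem card_sdiff_eq_card_sdiff_of_setOcc_add_eq {S S' : Finset (Triple e PH PS)} {x y x' y' : ι}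
    (h : setOcc Triple.u Triple.a Triple.b S + (Finsupp.single x' 1 + Finsupp.single y' 1) =
      setOcc Triple.u Triple.a Triple.b S' + (Finsupp.single x 1 + Finsupp.single y 1)) :
    (S \ S').card = (S' \ S).card := by
  have h2 := card_eq_of_setOcc_add_eq h
  have h3 := Finset.card_sdiff_add_card_inter S S'
  have h4 := Finset.card_sdiff_add_card_inter S' S
  rw [Finset.inter_comm] at h4
  omega

/-- **Type B (two different triples touched), structure I.** If `θ(S)`, `θ(S')`,
`d(S) + δ_{x'} + δ_{y'} = d(S') + δ_x + δ_y` with hard `x, y, x', y'`, the annihilated `x', y'` lie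
in two *different* triples `τ₁ ≠ τ₂` of `S'`, and `S ≠ S'`, then exactly these two triples are
replaced: `S' ∖ S = {τ₁, τ₂}` and `S ∖ S' = {τ_a, τ_b}` with `x ∈ τ_a`, `y ∈ τ_b` (hard slots) — case 2)
of [BastiCenatiempoSchlein2021, §5.3] ("there are two indices `i ≠ j` such that `a_p`, `a_{q+r}` are
contracted with `a†_{p̃ᵢ}`, `a†_{p̃ⱼ}` … in this case `a†_{-p̃ᵢ+vᵢ}`, `a†_{-p̃ⱼ+vⱼ}` have to be contracted
with `a_{-pᵢ+vᵢ}`, `a_{-pⱼ+vⱼ}`"); the one-triple case is excluded because then `{x', y'}` would be the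
hard pair of a single triple (`TripleAdm.hard_slots_of_sdiff_singleton`).
[cite: BastiCenatiempoSchlein2021, §5.3 (case 2), the term `V₂`)] -/
theorem TripleAdm.sdiff_eq_pair_of_cross (he : Function.Injective e) (hHS : Disjoint PH PS)
    {S S' : Finset (Triple e PH PS)} (hS : TripleAdm e S) (hS' : TripleAdm e S') {x y x' y' : ι}
    (hx : x ∈ PH) (hy : y ∈ PH) (hx' : x' ∈ PH) (hy' : y' ∈ PH)
    (h : setOcc Triple.u Triple.a Triple.b S + (Finsupp.single x' 1 + Finsupp.single y' 1) =
      setOcc Triple.u Triple.a Triple.b S' + (Finsupp.single x 1 + Finsupp.single y 1))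
    {τ₁ τ₂ : Triple e PH PS} (h₁ : τ₁ ∈ S') (h₂ : τ₂ ∈ S') (h12 : τ₁ ≠ τ₂)
    (hx₁ : x' = τ₁.u ∨ x' = τ₁.a) (hy₂ : y' = τ₂.u ∨ y' = τ₂.a) (hne : S ≠ S') :
    S' \ S = {τ₁, τ₂} ∧ ∃ τa τb : Triple e PH PS, τa ≠ τb ∧ S \ S' = {τa, τb} ∧
      (x = τa.u ∨ x = τa.a) ∧ (y = τb.u ∨ y = τb.a) := by
  classical
  have hcard := card_sdiff_eq_card_sdiff_of_setOcc_add_eq h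
  have hle2 : (S \ S').card ≤ 2 := hS.card_sdiff_le_two hHS hS' hx hy hx' hy' h
  -- in `S'`, the triple with hard slot `x'` is `τ₁`, the one with `y'` is `τ₂`
  have hτ₁uniq : ∀ {τ : Triple e PH PS}, τ ∈ S' → (x' = τ.u ∨ x' = τ.a) → τ = τ₁ := by
    intro τ hτ hslot
    by_contra hne'
    exact hS'.hard_ne hτ h₁ hne' (mem_hardPair_of hslot) (mem_hardPair_of hx₁)
  have hτ₂uniq : ∀ {τ : Triple e PH PS}, τ ∈ S' → (y' = τ.u ∨ y' = τ.a) → τ = τ₂ := by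
    intro τ hτ hslot
    by_contra hne'
    exact hS'.hard_ne hτ h₂ hne' (mem_hardPair_of hslot) (mem_hardPair_of hy₂)
  -- `|S ∖ S'| ≠ 0`
  have hk0 : (S \ S').card ≠ 0 := by
    intro h0
    apply hne
    rw [Finset.card_eq_zero, Finset.sdiff_eq_empty_iff_subset] at h0
    exact Finset.eq_of_subset_of_card_le h0 (card_eq_of_setOcc_add_eq h).ge
  -- `|S ∖ S'| ≠ 1`: otherwise `{x', y'}` is the hard pair of the single differing triple of `S'`
  have hk1 : (S \ S').card ≠ 1 := by
    intro h1
    have h1' : (S' \ S).card = 1 := hcard ▸ h1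
    obtain ⟨τ', hD'⟩ := Finset.card_eq_one.1 h1'
    have hτ'S' : τ' ∈ S' := by
      have : τ' ∈ S' \ S := by rw [hD']; exact Finset.mem_singleton_self τ'
      exact (Finset.mem_sdiff.1 this).1
    obtain ⟨hu, ha⟩ := hS'.hard_slots_of_sdiff_singleton he hHS hx' hy' hx hy h.symm hD'
    have hua : τ'.u ≠ τ'.a := ne_of_lt τ'.prop.2.2.2.2
    rcases hu with hu | hu <;> rcases ha with ha | ha
    · exact hua (hu.trans ha.symm)
    · exact h12 ((hτ₁uniq hτ'S' (Or.inl hu.symm)).symm.trans (hτ₂uniq hτ'S' (Or.inr ha.symm)))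
    · exact h12 ((hτ₁uniq hτ'S' (Or.inr ha.symm)).symm.trans (hτ₂uniq hτ'S' (Or.inl hu.symm)))
    · exact hua (hu.trans ha.symm)
  have hk2 : (S \ S').card = 2 := by omega
  -- `S' ∖ S = {τ₁, τ₂}`
  have hsub' : S' \ S ⊆ {τ₁, τ₂} := by
    intro τ hτ
    obtain ⟨hτS', hτS⟩ := Finset.mem_sdiff.1 hτ
    rcases hS.pinned_of_setOcc_eq hHS hx' hy' hx hy h.symm hτS' hτS with hh | hh | hh | hh
    · rw [hτ₁uniq hτS' (Or.inl hh.symm)]; simp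
    · rw [hτ₂uniq hτS' (Or.inl hh.symm)]; simp
    · rw [hτ₁uniq hτS' (Or.inr hh.symm)]; simp
    · rw [hτ₂uniq hτS' (Or.inr hh.symm)]; simp
  have hD' : S' \ S = {τ₁, τ₂} := by
    refine Finset.eq_of_subset_of_card_le hsub' ?_
    rw [Finset.card_pair h12, ← hcard, hk2]
  -- `S ∖ S' = {τa, τb}` with `x ∈ τa`, `y ∈ τb`
  obtain ⟨τa, τb, hab, hD⟩ := Finset.card_eq_two.1 hk2
  have hτaD : τa ∈ S \ S' := by rw [hD]; simp
  have hτbD : τb ∈ S \ S' := by rw [hD]; simp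
  obtain ⟨hτaS, hτaS'⟩ := Finset.mem_sdiff.1 hτaD
  obtain ⟨hτbS, hτbS'⟩ := Finset.mem_sdiff.1 hτbD
  have hpa := hS'.pinned_of_setOcc_eq hHS hx hy hx' hy' h hτaS hτaS'
  have hpb := hS'.pinned_of_setOcc_eq hHS hx hy hx' hy' h hτbS hτbS'
  have hnot : ∀ {p : ι}, (p = τa.u ∨ p = τa.a) → (p = τb.u ∨ p = τb.a) → False :=
    fun hpa' hpb' => hS.hard_ne hτaS hτbS hab (mem_hardPair_of hpa') (mem_hardPair_of hpb')
  refine ⟨hD', ?_⟩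
  by_cases hax : x = τa.u ∨ x = τa.a
  · have hby : y = τb.u ∨ y = τb.a := by
      rcases hpb with hh | hh | hh | hh
      · exact absurd (Or.inl hh.symm) (fun hbx => hnot hax hbx)
      · exact Or.inl hh.symm
      · exact absurd (Or.inr hh.symm) (fun hbx => hnot hax hbx)
      · exact Or.inr hh.symm
    exact ⟨τa, τb, hab, hD, hax, hby⟩
  · have hay : y = τa.u ∨ y = τa.a := by
      rcases hpa with hh | hh | hh | hh
      · exact absurd (Or.inl hh.symm) hax
      · exact Or.inl hh.symm
      · exact absurd (Or.inr hh.symm) hax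
      · exact Or.inr hh.symm
    have hbx : x = τb.u ∨ x = τb.a := by
      rcases hpb with hh | hh | hh | hh
      · exact Or.inl hh.symm
      · exact absurd (Or.inl hh.symm) (fun hby => hnot hay hby)
      · exact Or.inr hh.symm
      · exact absurd (Or.inr hh.symm) (fun hby => hnot hay hby)
    refine ⟨τb, τa, hab.symm, ?_, hbx, hay⟩
    rw [hD, Finset.pair_comm]

/-- **Type B, structure II: how the replaced triples match.** In the situation of
`TripleAdm.sdiff_eq_pair_of_cross` (`S' ∖ S = {τ₁, τ₂}`, `S ∖ S' = {ρ, ρ̄}`, the created `z` a hard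
slot of `ρ`, the created `z̄` a hard slot of `ρ̄`), the new triple `ρ` is assembled from `z`, the soft
slot of one of `τ₁, τ₂` and the *spare* hard slot of the *other* one: either
`b_ρ = b_{τ₁}` and the other hard slot of `ρ` is the other hard slot of `τ₂`, or `b_ρ = b_{τ₂}` and the
other hard slot of `ρ` is the other hard slot of `τ₁` ("`a†_{-p̃ᵢ+vᵢ}`, `a†_{-p̃ⱼ+vⱼ}` have to be
contracted with `a_{-pᵢ+vᵢ}`, `a_{-pⱼ+vⱼ}`"; the un-mixed option would give `ρ = τ₁` resp. `ρ = τ₂`).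
[cite: BastiCenatiempoSchlein2021, §5.3 (case 2), the contractions defining `V₂`)] -/
theorem TripleAdm.cross_slots (he : Function.Injective e) (hHS : Disjoint PH PS)
    {S S' : Finset (Triple e PH PS)} (hS : TripleAdm e S) (hS' : TripleAdm e S') {z zb x' y' : ι}
    (hx' : x' ∈ PH) (hy' : y' ∈ PH)
    (h : setOcc Triple.u Triple.a Triple.b S + (Finsupp.single x' 1 + Finsupp.single y' 1) =
      setOcc Triple.u Triple.a Triple.b S' + (Finsupp.single z 1 + Finsupp.single zb 1))
    {τ₁ τ₂ : Triple e PH PS} (h₁ : τ₁ ∈ S') (h12 : τ₁ ≠ τ₂)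
    (hx₁ : x' = τ₁.u ∨ x' = τ₁.a) (hy₂ : y' = τ₂.u ∨ y' = τ₂.a) (hD' : S' \ S = {τ₁, τ₂})
    {ρ ρb : Triple e PH PS} (hρρ : ρ ≠ ρb) (hD : S \ S' = {ρ, ρb})
    (hz : z = ρ.u ∨ z = ρ.a) (hzb : zb = ρb.u ∨ zb = ρb.a) :
    (ρ.b = τ₁.b ∧ (if z = ρ.u then ρ.a else ρ.u) = (if y' = τ₂.u then τ₂.a else τ₂.u)) ∨
    (ρ.b = τ₂.b ∧ (if z = ρ.u then ρ.a else ρ.u) = (if x' = τ₁.u then τ₁.a else τ₁.u)) := by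
  classical
  -- memberships
  have hρD : ρ ∈ S \ S' := by rw [hD]; simp
  have hρbD : ρb ∈ S \ S' := by rw [hD]; simp
  obtain ⟨hρS, hρS'⟩ := Finset.mem_sdiff.1 hρD
  obtain ⟨hρbS, -⟩ := Finset.mem_sdiff.1 hρbD
  have hτ₁D : τ₁ ∈ S' \ S := by rw [hD']; simp
  have hτ₂D : τ₂ ∈ S' \ S := by rw [hD']; simp
  obtain ⟨-, hτ₁S⟩ := Finset.mem_sdiff.1 hτ₁D
  obtain ⟨hτ₂S', hτ₂S⟩ := Finset.mem_sdiff.1 hτ₂D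
  have pρ := ρ.prop; have pρb := ρb.prop; have p₁ := τ₁.prop; have p₂ := τ₂.prop
  -- the reduced occupation identity on `{ρ, ρ̄}` versus `{τ₁, τ₂}`
  have hred : ∀ i, tripleOcc Triple.u Triple.a Triple.b ρ i + tripleOcc Triple.u Triple.a Triple.b ρb i +
      ((if x' = i then 1 else 0) + (if y' = i then 1 else 0)) =
      tripleOcc Triple.u Triple.a Triple.b τ₁ i + tripleOcc Triple.u Triple.a Triple.b τ₂ i +
      ((if z = i then 1 else 0) + (if zb = i then 1 else 0)) := by
    intro i
    have hi := congrArg (fun f => f i) h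
    simp only [Finsupp.coe_add, Pi.add_apply, Finsupp.single_apply] at hi
    rw [setOcc_eq_sdiff_add_inter S S', setOcc_eq_sdiff_add_inter S' S, hD, hD', setOcc_pair hρρ,
      setOcc_pair h12, Finset.inter_comm S' S] at hi
    simp only [Finsupp.coe_add, Pi.add_apply] at hi
    omega
  -- disjointness facts
  have hPHPS : ∀ {p q : ι}, p ∈ PH → q ∈ PS → p ≠ q := fun hp hq hpq =>
    Finset.disjoint_left.1 hHS hp (hpq ▸ hq)
  have hzH : z ∈ PH := by rcases hz with rfl | rfl; exacts [pρ.1, pρ.2.1]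
  have hzbH : zb ∈ PH := by rcases hzb with rfl | rfl; exacts [pρb.1, pρb.2.1]
  -- (1) soft slot: `ρ.b ∈ {τ₁.b, τ₂.b}`
  have hsoft : ρ.b = τ₁.b ∨ ρ.b = τ₂.b := by
    have hi := hred ρ.b
    rw [tripleOcc_apply_of_mem_PS hHS ρ pρ.2.2.1, tripleOcc_apply_of_mem_PS hHS ρb pρ.2.2.1,
      tripleOcc_apply_of_mem_PS hHS τ₁ pρ.2.2.1, tripleOcc_apply_of_mem_PS hHS τ₂ pρ.2.2.1,
      if_pos rfl, if_neg (fun hh => hρρ (hS.b_injOn hρS hρbS hh.symm)),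
      if_neg (hPHPS hx' pρ.2.2.1), if_neg (hPHPS hy' pρ.2.2.1), if_neg (hPHPS hzH pρ.2.2.1),
      if_neg (hPHPS hzbH pρ.2.2.1)] at hi
    by_contra hno
    push Not at hno
    rw [if_neg (fun hh => hno.1 hh.symm), if_neg (fun hh => hno.2 hh.symm)] at hi
    simp at hi
  -- (2) the other hard slot `p` of `ρ`
  set p : ι := if z = ρ.u then ρ.a else ρ.u with hpdef
  have hua : ρ.u ≠ ρ.a := ne_of_lt pρ.2.2.2.2
  have hpρ : p = ρ.u ∨ p = ρ.a := by
    simp only [hpdef]; split_ifs <;> simp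
  have hpH : p ∈ PH := by rcases hpρ with hh | hh <;> rw [hh]; exacts [pρ.1, pρ.2.1]
  have hpz : p ≠ z := by
    simp only [hpdef]
    split_ifs with hzu
    · rw [hzu]; exact hua.symm
    · exact fun hh => hzu hh.symm
  have hzp : ¬ (p = ρ.u ∧ z = ρ.u) ∧ ¬ (p = ρ.a ∧ z = ρ.a) := by
    constructor
    · rintro ⟨h1, h2⟩; exact hpz (h1.trans h2.symm)
    · rintro ⟨h1, h2⟩; exact hpz (h1.trans h2.symm)
  have hpzb : p ≠ zb := by
    intro hh
    have hh' : p = ρb.u ∨ p = ρb.a := by rw [hh]; exact hzb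
    exact hS.hard_ne hρS hρbS hρρ (mem_hardPair_of hpρ) (mem_hardPair_of hh')
  have hpρb : ¬ (p = ρb.u ∨ p = ρb.a) := fun hh =>
    hS.hard_ne hρS hρbS hρρ (mem_hardPair_of hpρ) (mem_hardPair_of hh)
  -- occupation identity at `p`
  have hi := hred p
  rw [tripleOcc_apply_of_mem_PH hHS ρ hpH, tripleOcc_apply_of_mem_PH hHS ρb hpH,
    tripleOcc_apply_of_mem_PH hHS τ₁ hpH, tripleOcc_apply_of_mem_PH hHS τ₂ hpH, if_pos hpρ, if_neg hpρb,
    if_neg (show ¬ z = p from fun hh => hpz hh.symm), if_neg (show ¬ zb = p from fun hh => hpzb hh.symm),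
    add_zero, add_zero] at hi
  -- `x' ≠ p` and `y' ≠ p`
  have h12hard : ∀ {q : ι}, (q = τ₁.u ∨ q = τ₁.a) → (q = τ₂.u ∨ q = τ₂.a) → False :=
    fun hq₁ hq₂ => hS'.hard_ne h₁ hτ₂S' h12 (mem_hardPair_of hq₁) (mem_hardPair_of hq₂)
  have hx'p : x' ≠ p := by
    intro hh
    have hp₁ : p = τ₁.u ∨ p = τ₁.a := hh ▸ hx₁
    rw [if_pos (show x' = p from hh), if_pos hp₁] at hi
    have hp₂ : p = τ₂.u ∨ p = τ₂.a := by
      by_contra hno; rw [if_neg hno] at hi; split_ifs at hi <;> omega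
    exact h12hard hp₁ hp₂
  have hy'p : y' ≠ p := by
    intro hh
    have hp₂ : p = τ₂.u ∨ p = τ₂.a := hh ▸ hy₂
    rw [if_pos (show y' = p from hh), if_pos hp₂, if_neg (show ¬ x' = p from hx'p)] at hi
    have hp₁ : p = τ₁.u ∨ p = τ₁.a := by
      by_contra hno; rw [if_neg hno] at hi; omega
    exact h12hard hp₁ hp₂
  rw [if_neg (show ¬ x' = p from hx'p), if_neg (show ¬ y' = p from hy'p), add_zero, add_zero] at hi
  -- so `p` is a hard slot of exactly one of `τ₁, τ₂`
  have hp12 : (p = τ₁.u ∨ p = τ₁.a) ∨ (p = τ₂.u ∨ p = τ₂.a) := by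
    by_contra hno
    have hn₁ : ¬ (p = τ₁.u ∨ p = τ₁.a) := fun hh => hno (Or.inl hh)
    have hn₂ : ¬ (p = τ₂.u ∨ p = τ₂.a) := fun hh => hno (Or.inr hh)
    rw [if_neg hn₁, if_neg hn₂] at hi
    simp at hi
  -- exclusions: the un-mixed options would give `ρ = τ₁` or `ρ = τ₂`
  have hex₁ : ¬ (ρ.b = τ₁.b ∧ (p = τ₁.u ∨ p = τ₁.a)) := by
    rintro ⟨hb, hp₁⟩
    have := Triple.eq_of_b_eq_of_hard_mem he hb hpρ hp₁
    exact hτ₁S (this ▸ hρS)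
  have hex₂ : ¬ (ρ.b = τ₂.b ∧ (p = τ₂.u ∨ p = τ₂.a)) := by
    rintro ⟨hb, hp₂⟩
    have := Triple.eq_of_b_eq_of_hard_mem he hb hpρ hp₂
    exact hτ₂S (this ▸ hρS)
  -- the other hard slot of `τ₁` (resp. `τ₂`)
  have hoth₁ : (p = τ₁.u ∨ p = τ₁.a) → p = (if x' = τ₁.u then τ₁.a else τ₁.u) := by
    intro hp₁
    have hua₁ : τ₁.u ≠ τ₁.a := ne_of_lt p₁.2.2.2.2
    split_ifs with hxu
    · rcases hp₁ with hh | hh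
      · exact absurd (hxu.trans hh.symm) hx'p
      · exact hh
    · rcases hp₁ with hh | hh
      · exact hh
      · rcases hx₁ with hx₁ | hx₁
        · exact absurd hx₁ hxu
        · exact absurd (hx₁.trans hh.symm) hx'p
  have hoth₂ : (p = τ₂.u ∨ p = τ₂.a) → p = (if y' = τ₂.u then τ₂.a else τ₂.u) := by
    intro hp₂
    split_ifs with hyu
    · rcases hp₂ with hh | hh
      · exact absurd (hyu.trans hh.symm) hy'p
      · exact hh
    · rcases hp₂ with hh | hh
      · exact hh
      · rcases hy₂ with hy₂ | hy₂
        · exact absurd hy₂ hyu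
        · exact absurd (hy₂.trans hh.symm) hy'p
  rcases hsoft with hb | hb
  · left
    refine ⟨hb, ?_⟩
    rcases hp12 with hp₁ | hp₂
    · exact absurd ⟨hb, hp₁⟩ hex₁
    · exact hoth₂ hp₂
  · right
    refine ⟨hb, ?_⟩
    rcases hp12 with hp₁ | hp₂
    · exact hoth₁ hp₁
    · exact absurd ⟨hb, hp₂⟩ hex₂


/-- In an admissible set, the triples having a given hard slot of a member triple form that singleton.
[folklore] -/
theorem TripleAdm.filter_hard_eq_singleton {S : Finset (Triple e PH PS)} (hS : TripleAdm e S)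
    {τ : Triple e PH PS} (hτ : τ ∈ S) {x : ι} (hx : x = τ.u ∨ x = τ.a) :
    (S.filter fun τ' => x = τ'.u ∨ x = τ'.a) = {τ} := by
  ext τ'
  simp only [Finset.mem_filter, Finset.mem_singleton]
  constructor
  · rintro ⟨hτ'S, hx'⟩
    by_contra hne
    exact hS.hard_ne hτ'S hτ hne (mem_hardPair_of hx') (mem_hardPair_of hx)
  · rintro rfl; exact ⟨hτ, hx⟩

/-- The "other hard slot" determines the slot. [folklore] -/
theorem Triple.eq_of_other_eq {τ : Triple e PH PS} {z z' : ι} (hz : z = τ.u ∨ z = τ.a)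
    (hz' : z' = τ.u ∨ z' = τ.a)
    (h : (if z = τ.u then τ.a else τ.u) = (if z' = τ.u then τ.a else τ.u)) : z = z' := by
  have hua : τ.u ≠ τ.a := ne_of_lt τ.prop.2.2.2.2
  by_cases h1 : z = τ.u <;> by_cases h2 : z' = τ.u
  · exact h1.trans h2.symm
  · rw [if_pos h1, if_neg h2] at h; exact absurd h.symm hua
  · rw [if_neg h1, if_pos h2] at h; exact absurd h hua
  · rcases hz with hz | hz
    · exact absurd hz h1
    · rcases hz' with hz' | hz'
      · exact absurd hz' h2
      · exact hz.trans hz'.symm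

/-- The other hard slot is a hard slot. [folklore] -/
theorem Triple.other_mem {τ : Triple e PH PS} (z : ι) :
    (if z = τ.u then τ.a else τ.u) = τ.u ∨ (if z = τ.u then τ.a else τ.u) = τ.a := by
  split_ifs <;> simp

/-- **Type B: at most four partners.** For `θ(S')` and annihilated modes `x' ∈ τ₁`, `y' ∈ τ₂` in two
different triples of `S'`, there are at most four `(S, x, y)` (`θ(S)`, hard `x ≠ y`) with
`d(S) + δ_{x'} + δ_{y'} = d(S') + δ_x + δ_y`: the diagonal `S = S'`, `{x, y} = {x', y'}` (two orders) and
the two mixed re-pairings of `TripleAdm.cross_slots` — the finitely many "possible contractions" of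
[BastiCenatiempoSchlein2021, §5.3, case 2)] behind the bound (5.19) for `V₂`.
[cite: BastiCenatiempoSchlein2021, §5.3 (the term `V₂`, "we consider all possible contractions")] -/
theorem TripleAdm.card_partners_le_four [Fintype ι] (he : Function.Injective e) (hHS : Disjoint PH PS)
    {S' : Finset (Triple e PH PS)} (hS' : TripleAdm e S') {x' y' : ι} {τ₁ τ₂ : Triple e PH PS}
    (h₁ : τ₁ ∈ S') (h₂ : τ₂ ∈ S') (h12 : τ₁ ≠ τ₂) (hx₁ : x' = τ₁.u ∨ x' = τ₁.a)
    (hy₂ : y' = τ₂.u ∨ y' = τ₂.a) :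
    ((Finset.univ : Finset (Finset (Triple e PH PS) × ι × ι)).filter (fun q =>
        TripleAdm e q.1 ∧ q.2.1 ∈ PH ∧ q.2.2 ∈ PH ∧ q.2.1 ≠ q.2.2 ∧
        setOcc Triple.u Triple.a Triple.b q.1 + (Finsupp.single x' 1 + Finsupp.single y' 1) =
          setOcc Triple.u Triple.a Triple.b S' + (Finsupp.single q.2.1 1 + Finsupp.single q.2.2 1))).card
      ≤ 4 := by
  classical
  have hx' : x' ∈ PH := by rcases hx₁ with hh | hh <;> rw [hh]; exacts [τ₁.prop.1, τ₁.prop.2.1]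
  have hy' : y' ∈ PH := by rcases hy₂ with hh | hh <;> rw [hh]; exacts [τ₂.prop.1, τ₂.prop.2.1]
  have hb12 : τ₁.b ≠ τ₂.b := fun hh => h12 (hS'.b_injOn h₁ h₂ hh)
  -- the classifying map
  let f : Finset (Triple e PH PS) × ι × ι → Bool × Finset ι := fun q =>
    (decide (q.1 = S'), (q.1.filter fun τ => q.2.1 = τ.u ∨ q.2.1 = τ.a).image Triple.b)
  let tgt : Finset (Bool × Finset ι) :=
    (Finset.univ : Finset Bool) ×ˢ ({{τ₁.b}, {τ₂.b}} : Finset (Finset ι))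
  have htgt : tgt.card ≤ 4 := by
    have h2 : ({{τ₁.b}, {τ₂.b}} : Finset (Finset ι)).card ≤ 2 := Finset.card_le_two
    have hB : (Finset.univ : Finset Bool).card = 2 := by simp
    simp only [tgt, Finset.card_product, hB]
    omega
  -- the structure of a partner `(S, x, y)`
  have key : ∀ {S : Finset (Triple e PH PS)} {x y : ι}, TripleAdm e S → x ∈ PH → y ∈ PH → x ≠ y →
      setOcc Triple.u Triple.a Triple.b S + (Finsupp.single x' 1 + Finsupp.single y' 1) =
        setOcc Triple.u Triple.a Triple.b S' + (Finsupp.single x 1 + Finsupp.single y 1) →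
      (S = S' ∧ ((x = x' ∧ y = y') ∨ (x = y' ∧ y = x'))) ∨
      (S ≠ S' ∧ S' \ S = {τ₁, τ₂} ∧ ∃ τa τb : Triple e PH PS, τa ≠ τb ∧ S \ S' = {τa, τb} ∧
        (x = τa.u ∨ x = τa.a) ∧ (y = τb.u ∨ y = τb.a) ∧
        ((τa.b = τ₁.b ∧ (if x = τa.u then τa.a else τa.u) = (if y' = τ₂.u then τ₂.a else τ₂.u)) ∨
          (τa.b = τ₂.b ∧ (if x = τa.u then τa.a else τa.u) = (if x' = τ₁.u then τ₁.a else τ₁.u))) ∧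
        ((τb.b = τ₁.b ∧ (if y = τb.u then τb.a else τb.u) = (if y' = τ₂.u then τ₂.a else τ₂.u)) ∨
          (τb.b = τ₂.b ∧ (if y = τb.u then τb.a else τb.u) = (if x' = τ₁.u then τ₁.a else τ₁.u)))) := by
    intro S x y hS hx hy hxy h
    by_cases hSS : S = S'
    · left
      refine ⟨hSS, ?_⟩
      subst hSS
      rcases pair_eq_of_setOcc_add_eq S hxy h with ⟨h1, h2⟩ | ⟨h1, h2⟩
      · exact Or.inl ⟨h1.symm, h2.symm⟩
      · exact Or.inr ⟨h2.symm, h1.symm⟩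
    · right
      obtain ⟨hD', τa, τb, hab, hD, hxa, hyb⟩ :=
        hS.sdiff_eq_pair_of_cross he hHS hS' hx hy hx' hy' h h₁ h₂ h12 hx₁ hy₂ hSS
      have hca := TripleAdm.cross_slots he hHS hS hS' hx' hy' h h₁ h12 hx₁ hy₂ hD' hab hD hxa hyb
      have h' : setOcc Triple.u Triple.a Triple.b S + (Finsupp.single x' 1 + Finsupp.single y' 1) =
          setOcc Triple.u Triple.a Triple.b S' + (Finsupp.single y 1 + Finsupp.single x 1) := by
        rw [h, add_comm (Finsupp.single x 1)]
      have hDb : S \ S' = {τb, τa} := by rw [hD, Finset.pair_comm]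
      have hcb := TripleAdm.cross_slots he hHS hS hS' hx' hy' h' h₁ h12 hx₁ hy₂ hD' hab.symm hDb hyb hxa
      exact ⟨hSS, hD', τa, τb, hab, hD, hxa, hyb, hca, hcb⟩
  refine le_trans (Finset.card_le_card_of_injOn f ?_ ?_) htgt
  · -- maps into the target
    rintro ⟨S, x, y⟩ hq
    simp only [Finset.coe_filter, Finset.mem_univ, true_and, Set.mem_setOf_eq] at hq
    obtain ⟨hS, hx, hy, hxy, h⟩ := hq
    simp only [f, tgt, Finset.coe_product, Set.mem_prod, Finset.mem_coe, Finset.mem_univ, true_and,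
      Finset.mem_insert, Finset.mem_singleton]
    rcases key hS hx hy hxy h with ⟨rfl, hxy'⟩ | ⟨-, -, τa, τb, -, hD, hxa, -, hca, -⟩
    · rcases hxy' with ⟨rfl, -⟩ | ⟨rfl, -⟩
      · left; rw [hS'.filter_hard_eq_singleton h₁ hx₁, Finset.image_singleton]
      · right; rw [hS'.filter_hard_eq_singleton h₂ hy₂, Finset.image_singleton]
    · have hτaS : τa ∈ S := (Finset.mem_sdiff.1 (by rw [hD]; simp : τa ∈ S \ S')).1
      rw [hS.filter_hard_eq_singleton hτaS hxa, Finset.image_singleton]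
      rcases hca with ⟨hb, -⟩ | ⟨hb, -⟩
      · left; rw [hb]
      · right; rw [hb]
  · -- injective on partners
    rintro ⟨S₁, x₁, y₁⟩ hq₁ ⟨S₂, x₂, y₂⟩ hq₂ hf
    simp only [Finset.coe_filter, Finset.mem_univ, true_and, Set.mem_setOf_eq] at hq₁ hq₂
    obtain ⟨hS₁, hx₁', hy₁', hxy₁, hh₁⟩ := hq₁
    obtain ⟨hS₂, hx₂', hy₂', hxy₂, hh₂⟩ := hq₂
    simp only [f, Prod.mk.injEq, decide_eq_decide] at hf
    obtain ⟨hdec, himg⟩ := hf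
    rcases key hS₁ hx₁' hy₁' hxy₁ hh₁ with ⟨hE₁, hxy₁'⟩ | ⟨hN₁, -, τa, τb, hab, hD, hxa, hyb, hca, hcb⟩
    · -- both diagonal
      have hE₂ : S₂ = S' := hdec.1 hE₁
      subst hE₁; subst hE₂
      simp only [Prod.mk.injEq, true_and]
      rcases key hS₂ hx₂' hy₂' hxy₂ hh₂ with ⟨-, hxy₂'⟩ | ⟨hN₂, -⟩
      · rcases hxy₁' with ⟨rfl, rfl⟩ | ⟨rfl, rfl⟩ <;> rcases hxy₂' with ⟨rfl, rfl⟩ | ⟨rfl, rfl⟩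
        · exact ⟨rfl, rfl⟩
        · rw [hS₁.filter_hard_eq_singleton h₁ hx₁, hS₁.filter_hard_eq_singleton h₂ hy₂,
            Finset.image_singleton, Finset.image_singleton, Finset.singleton_inj] at himg
          exact absurd himg hb12
        · rw [hS₁.filter_hard_eq_singleton h₁ hx₁, hS₁.filter_hard_eq_singleton h₂ hy₂,
            Finset.image_singleton, Finset.image_singleton, Finset.singleton_inj] at himg
          exact absurd himg.symm hb12
        · exact ⟨rfl, rfl⟩
      · exact absurd rfl hN₂
    · rcases key hS₂ hx₂' hy₂' hxy₂ hh₂ with ⟨hE₂, -⟩ | ⟨-, -, τa', τb', hab', hD₂, hxa', hyb', hca', hcb'⟩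
      · exact absurd (hdec.2 hE₂) hN₁
      · -- both off-diagonal: the images give `τa.b = τa'.b`
        have hτaS : τa ∈ S₁ := (Finset.mem_sdiff.1 (by rw [hD]; simp : τa ∈ S₁ \ S')).1
        have hτbS : τb ∈ S₁ := (Finset.mem_sdiff.1 (by rw [hD]; simp : τb ∈ S₁ \ S')).1
        have hτaS' : τa' ∈ S₂ := (Finset.mem_sdiff.1 (by rw [hD₂]; simp : τa' ∈ S₂ \ S')).1
        have hτbS' : τb' ∈ S₂ := (Finset.mem_sdiff.1 (by rw [hD₂]; simp : τb' ∈ S₂ \ S')).1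
        rw [hS₁.filter_hard_eq_singleton hτaS hxa, hS₂.filter_hard_eq_singleton hτaS' hxa',
          Finset.image_singleton, Finset.image_singleton, Finset.singleton_inj] at himg
        -- `τa = τa'`
        have hba : τa.b ≠ τb.b := fun hh => hab (hS₁.b_injOn hτaS hτbS hh)
        have hba' : τa'.b ≠ τb'.b := fun hh => hab' (hS₂.b_injOn hτaS' hτbS' hh)
        have hAeq : τa = τa' := by
          rcases hca with ⟨hb, ho⟩ | ⟨hb, ho⟩ <;> rcases hca' with ⟨hb', ho'⟩ | ⟨hb', ho'⟩
          · exact Triple.eq_of_b_eq_of_hard_mem he himg (Triple.other_mem x₁)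
              (by rw [ho.trans ho'.symm]; exact Triple.other_mem x₂)
          · exact absurd (hb.symm.trans (himg.trans hb')) hb12
          · exact absurd (hb'.symm.trans (himg.symm.trans hb)) hb12
          · exact Triple.eq_of_b_eq_of_hard_mem he himg (Triple.other_mem x₁)
              (by rw [ho.trans ho'.symm]; exact Triple.other_mem x₂)
        -- `τb.b = τb'.b`
        have hBb : τb.b = τb'.b := by
          have hTa : τa.b = τ₁.b ∨ τa.b = τ₂.b := by
            rcases hca with ⟨hb, -⟩ | ⟨hb, -⟩; exacts [Or.inl hb, Or.inr hb]
          have hTb : τb.b = τ₁.b ∨ τb.b = τ₂.b := by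
            rcases hcb with ⟨hb, -⟩ | ⟨hb, -⟩; exacts [Or.inl hb, Or.inr hb]
          have hTb' : τb'.b = τ₁.b ∨ τb'.b = τ₂.b := by
            rcases hcb' with ⟨hb, -⟩ | ⟨hb, -⟩; exacts [Or.inl hb, Or.inr hb]
          have hba'' : τa.b ≠ τb'.b := by rw [hAeq]; exact hba'
          rcases hTa with hTa | hTa <;> rcases hTb with hTb | hTb <;> rcases hTb' with hTb' | hTb'
          all_goals first
            | exact hTb.trans hTb'.symm
            | exact absurd (hTa.trans hTb.symm) hba
            | exact absurd (hTa.trans hTb'.symm) hba''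
        have hBeq : τb = τb' := by
          rcases hcb with ⟨hb, ho⟩ | ⟨hb, ho⟩ <;> rcases hcb' with ⟨hb', ho'⟩ | ⟨hb', ho'⟩
          · exact Triple.eq_of_b_eq_of_hard_mem he hBb (Triple.other_mem y₁)
              (by rw [ho.trans ho'.symm]; exact Triple.other_mem y₂)
          · exact absurd (hb.symm.trans (hBb.trans hb')) hb12
          · exact absurd (hb'.symm.trans (hBb.symm.trans hb)) hb12
          · exact Triple.eq_of_b_eq_of_hard_mem he hBb (Triple.other_mem y₁)
              (by rw [ho.trans ho'.symm]; exact Triple.other_mem y₂)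
        subst hAeq; subst hBeq
        -- the modes
        have hxeq : x₁ = x₂ := by
          refine Triple.eq_of_other_eq hxa hxa' ?_
          rcases hca with ⟨hb, ho⟩ | ⟨hb, ho⟩ <;> rcases hca' with ⟨hb', ho'⟩ | ⟨hb', ho'⟩
          · exact ho.trans ho'.symm
          · exact absurd (hb.symm.trans hb') hb12
          · exact absurd (hb'.symm.trans hb) hb12
          · exact ho.trans ho'.symm
        have hyeq : y₁ = y₂ := by
          refine Triple.eq_of_other_eq hyb hyb' ?_
          rcases hcb with ⟨hb, ho⟩ | ⟨hb, ho⟩ <;> rcases hcb' with ⟨hb', ho'⟩ | ⟨hb', ho'⟩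
          · exact ho.trans ho'.symm
          · exact absurd (hb.symm.trans hb') hb12
          · exact absurd (hb'.symm.trans hb) hb12
          · exact ho.trans ho'.symm
        -- the sets
        have hSeq : S₁ = S₂ := by
          have e1 : S₁ = S₁ \ S' ∪ S' \ (S' \ S₁) := by
            rw [Finset.sdiff_sdiff_self_left, Finset.inter_comm, Finset.sdiff_union_inter]
          have e2 : S₂ = S₂ \ S' ∪ S' \ (S' \ S₂) := by
            rw [Finset.sdiff_sdiff_self_left, Finset.inter_comm, Finset.sdiff_union_inter]
          rw [e1, e2, hD, hD₂]
          rcases key hS₁ hx₁' hy₁' hxy₁ hh₁ with ⟨hE, -⟩ | ⟨-, hD'₁, -⟩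
          · exact absurd hE hN₁
          rcases key hS₂ hx₂' hy₂' hxy₂ hh₂ with ⟨hE, -⟩ | ⟨-, hD'₂, -⟩
          · exact absurd (hdec.2 hE) hN₁
          rw [hD'₁, hD'₂]
        subst hSeq; subst hxeq; subst hyeq
        rfl

end TypeBStructure

/-! ### Type-B contractions: annihilation of two hard modes, no partner for a same-triple pair,
and the summed partner count -/

section TypeBCount

/-- **Two annihilations of an admissible monomial**: `a_ya_x (c X^{d(S)}) = c X^{d(S)-δ_x-δ_y}` if
`x ≠ y` are occupied in `S`, and `0` otherwise (squarefree occupations). [folklore] -/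
theorem TripleAdm.pderiv_pderiv_monomial_setOcc (hHS : Disjoint PH PS) {S : Finset (Triple e PH PS)}
    (hS : TripleAdm e S) (x y : ι) (c : ℂ) :
    pderiv y (pderiv x (monomial (setOcc Triple.u Triple.a Triple.b S) c)) =
      if setOcc Triple.u Triple.a Triple.b S x ≠ 0 ∧ setOcc Triple.u Triple.a Triple.b S y ≠ 0 ∧ x ≠ y then
        monomial (setOcc Triple.u Triple.a Triple.b S - Finsupp.single x 1 - Finsupp.single y 1) c
      else 0 := by
  classical
  rw [pderiv_pderiv_monomial]
  have hx1 := hS.setOcc_le_one hHS x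
  have hy1 := hS.setOcc_le_one hHS y
  split_ifs with h
  · obtain ⟨hx, hy, hxy⟩ := h
    have hx' : setOcc Triple.u Triple.a Triple.b S x = 1 := by omega
    have hy' : (setOcc Triple.u Triple.a Triple.b S - Finsupp.single x 1 : ι →₀ ℕ) y = 1 := by
      rw [Finsupp.tsub_apply, Finsupp.single_apply, if_neg hxy]; omega
    rw [hx', hy']
    simp
  · have h0 : (c * (setOcc Triple.u Triple.a Triple.b S x : ℂ) *
        ((setOcc Triple.u Triple.a Triple.b S - Finsupp.single x 1 : ι →₀ ℕ) y : ℂ)) = 0 := by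
      by_cases hx : setOcc Triple.u Triple.a Triple.b S x = 0
      · rw [hx]; simp
      by_cases hxy : x = y
      · subst hxy
        have : (setOcc Triple.u Triple.a Triple.b S - Finsupp.single x 1 : ι →₀ ℕ) x = 0 := by
          rw [Finsupp.tsub_apply, Finsupp.single_eq_same]; omega
        rw [this]; simp
      have hy : setOcc Triple.u Triple.a Triple.b S y = 0 := by
        by_contra hy; exact h ⟨hx, hy, hxy⟩
      have : (setOcc Triple.u Triple.a Triple.b S - Finsupp.single x 1 : ι →₀ ℕ) y = 0 := by
        rw [Finsupp.tsub_apply, Finsupp.single_apply, if_neg hxy, hy, Nat.zero_sub]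
      rw [this]; simp
    rw [h0, map_zero]

/-- **Hard-mode sums reindexed by the triples (version over `P_H`-sums).**
[cite: BastiCenatiempoSchlein2021, §5.3 (cases 1) and 2))] -/
theorem TripleAdm.sum_PH_sum_PH_ite_occupied_ne [Fintype ι] (hHS : Disjoint PH PS)
    {S : Finset (Triple e PH PS)} (hS : TripleAdm e S) (f : ι → ι → ℂ) :
    ∑ x ∈ PH, ∑ y ∈ PH, (if setOcc Triple.u Triple.a Triple.b S x ≠ 0 ∧
        setOcc Triple.u Triple.a Triple.b S y ≠ 0 ∧ x ≠ y then f x y else 0) =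
      ∑ τ ∈ S, (f τ.u τ.a + f τ.a τ.u) +
        ∑ τ₁ ∈ S, ∑ τ₂ ∈ S.erase τ₁, (f τ₁.u τ₂.u + f τ₁.u τ₂.a + f τ₁.a τ₂.u + f τ₁.a τ₂.a) := by
  classical
  rw [← hS.sum_sum_ite_hard_occupied_ne hHS f, ← Finset.sum_ite_mem_eq PH]
  refine Finset.sum_congr rfl fun x _ => ?_
  rw [← Finset.sum_ite_mem_eq PH]
  by_cases hx : x ∈ PH
  · rw [if_pos hx]
    refine Finset.sum_congr rfl fun y _ => ?_
    by_cases hy : y ∈ PH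
    · simp only [hx, hy, true_and, if_true]
    · rw [if_neg hy, if_neg (fun h => hy h.2.1.1)]
  · rw [if_neg hx]
    refine (Finset.sum_eq_zero fun y _ => ?_).symm
    rw [if_neg (fun h => hx h.1.1)]

/-- The exponent after annihilating the hard pair of a member triple: `d(S) - δ_u - δ_a = d(S∖τ) + δ_b`.
[folklore] -/
theorem setOcc_sub_hardPair {S : Finset (Triple e PH PS)} {τ : Triple e PH PS} (hτ : τ ∈ S) :
    setOcc Triple.u Triple.a Triple.b S - Finsupp.single τ.u 1 - Finsupp.single τ.a 1 =
      setOcc Triple.u Triple.a Triple.b (S.erase τ) + Finsupp.single τ.b 1 := by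
  rw [← setOcc_erase_add hτ]
  have ht : tripleOcc Triple.u Triple.a Triple.b τ =
      Finsupp.single τ.u 1 + Finsupp.single τ.a 1 + Finsupp.single τ.b 1 := rfl
  rw [ht]
  have hre : setOcc Triple.u Triple.a Triple.b (S.erase τ) +
      (Finsupp.single τ.u 1 + Finsupp.single τ.a 1 + Finsupp.single τ.b 1) =
      setOcc Triple.u Triple.a Triple.b (S.erase τ) + Finsupp.single τ.b 1 + Finsupp.single τ.a 1 +
        Finsupp.single τ.u 1 := by abel
  rw [hre, add_tsub_cancel_right, add_tsub_cancel_right]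

omit [DecidableEq ι] [LinearOrder ι] in
/-- For occupied `x ≠ y` (in `d`) and `x' ≠ y'` (in `d'`): equality of the annihilated exponents is the
additive matching condition `d + δ_{x'} + δ_{y'} = d' + δ_x + δ_y`. [folklore] -/
theorem tsub_tsub_eq_iff_add_add [DecidableEq ι] {d d' : ι →₀ ℕ} {x y x' y' : ι} (hxy : x ≠ y)
    (hx : 1 ≤ d x) (hy : 1 ≤ d y) (hxy' : x' ≠ y') (hx' : 1 ≤ d' x') (hy' : 1 ≤ d' y') :
    d - Finsupp.single x 1 - Finsupp.single y 1 = d' - Finsupp.single x' 1 - Finsupp.single y' 1 ↔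
      d + (Finsupp.single x' 1 + Finsupp.single y' 1) = d' + (Finsupp.single x 1 + Finsupp.single y 1) := by
  have e1 := tsub_tsub_add_add_of_mem hxy hx hy
  have e2 := tsub_tsub_add_add_of_mem hxy' hx' hy'
  set P := Finsupp.single x 1 + Finsupp.single y 1 with hP
  set P' := Finsupp.single x' 1 + Finsupp.single y' 1 with hP'
  constructor
  · intro h
    calc d + P' = (d - Finsupp.single x 1 - Finsupp.single y 1 + P) + P' := by rw [e1]
      _ = (d' - Finsupp.single x' 1 - Finsupp.single y' 1 + P) + P' := by rw [h]
      _ = d' - Finsupp.single x' 1 - Finsupp.single y' 1 + (P' + P) := by rw [add_assoc, add_comm P P']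
      _ = (d' - Finsupp.single x' 1 - Finsupp.single y' 1 + P') + P := by rw [← add_assoc]
      _ = d' + P := by rw [e2]
  · intro h
    have h' : d - Finsupp.single x 1 - Finsupp.single y 1 + (P + P') =
        d' - Finsupp.single x' 1 - Finsupp.single y' 1 + (P + P') := by
      calc d - Finsupp.single x 1 - Finsupp.single y 1 + (P + P')
          = (d - Finsupp.single x 1 - Finsupp.single y 1 + P) + P' := (add_assoc _ _ _).symm
        _ = d + P' := by rw [e1]
        _ = d' + P := h
        _ = (d' - Finsupp.single x' 1 - Finsupp.single y' 1 + P') + P := by rw [e2]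
        _ = d' - Finsupp.single x' 1 - Finsupp.single y' 1 + (P + P') := by rw [add_assoc, add_comm P' P]
    exact add_right_cancel h'

/-- **No partner for a same-triple pair against a cross pair**: if the created `x, y` form the hard
pair of one triple of `S` while the annihilated `x', y'` lie in two different triples of `S'`, the
occupations cannot match. [cite: BastiCenatiempoSchlein2021, §5.3 (cases 1) and 2) are disjoint)] -/
theorem TripleAdm.no_partner_same_cross (he : Function.Injective e) (hHS : Disjoint PH PS)
    {S S' : Finset (Triple e PH PS)} (hS : TripleAdm e S) (hS' : TripleAdm e S')
    {τ : Triple e PH PS} (hτ : τ ∈ S) {x y : ι} (hxy : (x = τ.u ∧ y = τ.a) ∨ (x = τ.a ∧ y = τ.u))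
    {τ₁ τ₂ : Triple e PH PS} (h₁ : τ₁ ∈ S') (h₂ : τ₂ ∈ S') (h12 : τ₁ ≠ τ₂) {x' y' : ι}
    (hx₁ : x' = τ₁.u ∨ x' = τ₁.a) (hy₂ : y' = τ₂.u ∨ y' = τ₂.a)
    (h : setOcc Triple.u Triple.a Triple.b S + (Finsupp.single x' 1 + Finsupp.single y' 1) =
      setOcc Triple.u Triple.a Triple.b S' + (Finsupp.single x 1 + Finsupp.single y 1)) : False := by
  classical
  have pτ := τ.prop
  have hxτ : x = τ.u ∨ x = τ.a := by
    rcases hxy with ⟨hx, -⟩ | ⟨hx, -⟩; exacts [Or.inl hx, Or.inr hx]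
  have hyτ : y = τ.u ∨ y = τ.a := by
    rcases hxy with ⟨-, hy⟩ | ⟨-, hy⟩; exacts [Or.inr hy, Or.inl hy]
  have hx : x ∈ PH := by rcases hxτ with hh | hh <;> rw [hh]; exacts [pτ.1, pτ.2.1]
  have hy : y ∈ PH := by rcases hyτ with hh | hh <;> rw [hh]; exacts [pτ.1, pτ.2.1]
  have hx' : x' ∈ PH := by rcases hx₁ with hh | hh <;> rw [hh]; exacts [τ₁.prop.1, τ₁.prop.2.1]
  have hy' : y' ∈ PH := by rcases hy₂ with hh | hh <;> rw [hh]; exacts [τ₂.prop.1, τ₂.prop.2.1]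
  have hxy' : x ≠ y := by
    have hua : τ.u ≠ τ.a := ne_of_lt pτ.2.2.2.2
    rcases hxy with ⟨hx, hy⟩ | ⟨hx, hy⟩
    · rw [hx, hy]; exact hua
    · rw [hx, hy]; exact hua.symm
  by_cases hne : S = S'
  · subst hne
    rcases pair_eq_of_setOcc_add_eq S hxy' h with ⟨e1, e2⟩ | ⟨e1, e2⟩
    · have hxτ' : x' = τ.u ∨ x' = τ.a := by rw [e1]; exact hxτ
      have hyτ' : y' = τ.u ∨ y' = τ.a := by rw [e2]; exact hyτ
      have f1 : τ₁ = τ := by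
        by_contra hn; exact hS.hard_ne h₁ hτ hn (mem_hardPair_of hx₁) (mem_hardPair_of hxτ')
      have f2 : τ₂ = τ := by
        by_contra hn; exact hS.hard_ne h₂ hτ hn (mem_hardPair_of hy₂) (mem_hardPair_of hyτ')
      exact h12 (f1.trans f2.symm)
    · have hxτ' : x' = τ.u ∨ x' = τ.a := by rw [e1]; exact hyτ
      have hyτ' : y' = τ.u ∨ y' = τ.a := by rw [e2]; exact hxτ
      have f1 : τ₁ = τ := by
        by_contra hn; exact hS.hard_ne h₁ hτ hn (mem_hardPair_of hx₁) (mem_hardPair_of hxτ')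
      have f2 : τ₂ = τ := by
        by_contra hn; exact hS.hard_ne h₂ hτ hn (mem_hardPair_of hy₂) (mem_hardPair_of hyτ')
      exact h12 (f1.trans f2.symm)
  · obtain ⟨-, τa, τb, hab, hD, hxa, hyb⟩ :=
      hS.sdiff_eq_pair_of_cross he hHS hS' hx hy hx' hy' h h₁ h₂ h12 hx₁ hy₂ hne
    have hτaS : τa ∈ S := (Finset.mem_sdiff.1 (by rw [hD]; simp : τa ∈ S \ S')).1
    have hτbS : τb ∈ S := (Finset.mem_sdiff.1 (by rw [hD]; simp : τb ∈ S \ S')).1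
    have f1 : τa = τ := by
      by_contra hn; exact hS.hard_ne hτaS hτ hn (mem_hardPair_of hxa) (mem_hardPair_of hxτ)
    have f2 : τb = τ := by
      by_contra hn; exact hS.hard_ne hτbS hτ hn (mem_hardPair_of hyb) (mem_hardPair_of hyτ)
    exact hab (f1.trans f2.symm)

/-- **Occupied hard pairs are same-triple pairs or cross pairs** (as an indicator identity, for
admissible `S` and hard `x, y`). [cite: BastiCenatiempoSchlein2021, §5.3 (cases 1) and 2))] -/
theorem TripleAdm.ite_occupied_ne_eq (hHS : Disjoint PH PS) {S : Finset (Triple e PH PS)}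
    (hS : TripleAdm e S) {x y : ι} (hx : x ∈ PH) (hy : y ∈ PH) (v : ℂ) :
    (if setOcc Triple.u Triple.a Triple.b S x ≠ 0 ∧ setOcc Triple.u Triple.a Triple.b S y ≠ 0 ∧ x ≠ y
      then v else 0) =
      (if ∃ τ ∈ S, (x = τ.u ∧ y = τ.a) ∨ (x = τ.a ∧ y = τ.u) then v else 0) +
      (if ∃ τ₁ ∈ S, ∃ τ₂ ∈ S, τ₁ ≠ τ₂ ∧ (x = τ₁.u ∨ x = τ₁.a) ∧ (y = τ₂.u ∨ y = τ₂.a) then v else 0) := by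
  classical
  -- hard occupied modes are hard slots
  have hslot : ∀ {z : ι}, z ∈ PH → setOcc Triple.u Triple.a Triple.b S z ≠ 0 →
      ∃ τ ∈ S, z = τ.u ∨ z = τ.a := by
    intro z hz hocc
    obtain ⟨τ, hτ, h⟩ := exists_slot_of_setOcc_ne_zero hocc
    refine ⟨τ, hτ, ?_⟩
    rcases h with h | h | h
    · exact Or.inl h.symm
    · exact Or.inr h.symm
    · exact absurd (h ▸ τ.prop.2.2.1) (Finset.disjoint_left.1 hHS hz)
  have hoccOf : ∀ {z : ι} {τ : Triple e PH PS}, τ ∈ S → (z = τ.u ∨ z = τ.a) →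
      setOcc Triple.u Triple.a Triple.b S z ≠ 0 := by
    intro z τ hτ hz
    rcases hz with rfl | rfl
    · exact (setOcc_slot_ne_zero hτ).1
    · exact (setOcc_slot_ne_zero hτ).2.1
  by_cases hsame : ∃ τ ∈ S, (x = τ.u ∧ y = τ.a) ∨ (x = τ.a ∧ y = τ.u)
  · obtain ⟨τ, hτ, hτxy⟩ := hsame
    have hxτ : x = τ.u ∨ x = τ.a := by rcases hτxy with ⟨h, -⟩ | ⟨h, -⟩; exacts [Or.inl h, Or.inr h]
    have hyτ : y = τ.u ∨ y = τ.a := by rcases hτxy with ⟨-, h⟩ | ⟨-, h⟩; exacts [Or.inr h, Or.inl h]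
    have hua : τ.u ≠ τ.a := ne_of_lt τ.prop.2.2.2.2
    have hxy : x ≠ y := by
      rcases hτxy with ⟨h1, h2⟩ | ⟨h1, h2⟩
      · rw [h1, h2]; exact hua
      · rw [h1, h2]; exact hua.symm
    have hncross : ¬ ∃ τ₁ ∈ S, ∃ τ₂ ∈ S, τ₁ ≠ τ₂ ∧ (x = τ₁.u ∨ x = τ₁.a) ∧ (y = τ₂.u ∨ y = τ₂.a) := by
      rintro ⟨τ₁, h₁, τ₂, h₂, h12, hx₁, hy₂⟩
      have e1 : τ₁ = τ := by
        by_contra hn; exact hS.hard_ne h₁ hτ hn (mem_hardPair_of hx₁) (mem_hardPair_of hxτ)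
      have e2 : τ₂ = τ := by
        by_contra hn; exact hS.hard_ne h₂ hτ hn (mem_hardPair_of hy₂) (mem_hardPair_of hyτ)
      exact h12 (e1.trans e2.symm)
    rw [if_pos ⟨hoccOf hτ hxτ, hoccOf hτ hyτ, hxy⟩, if_pos ⟨τ, hτ, hτxy⟩, if_neg hncross, add_zero]
  · rw [if_neg hsame, zero_add]
    by_cases hocc : setOcc Triple.u Triple.a Triple.b S x ≠ 0 ∧ setOcc Triple.u Triple.a Triple.b S y ≠ 0 ∧ x ≠ y
    · obtain ⟨hox, hoy, hxy⟩ := hocc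
      obtain ⟨τ₁, h₁, hx₁⟩ := hslot hx hox
      obtain ⟨τ₂, h₂, hy₂⟩ := hslot hy hoy
      have h12 : τ₁ ≠ τ₂ := by
        rintro rfl
        apply hsame
        refine ⟨τ₁, h₁, ?_⟩
        have hua : τ₁.u ≠ τ₁.a := ne_of_lt τ₁.prop.2.2.2.2
        rcases hx₁ with hx₁ | hx₁ <;> rcases hy₂ with hy₂ | hy₂
        · exact absurd (hx₁.trans hy₂.symm) hxy
        · exact Or.inl ⟨hx₁, hy₂⟩
        · exact Or.inr ⟨hx₁, hy₂⟩
        · exact absurd (hx₁.trans hy₂.symm) hxy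
      rw [if_pos ⟨hox, hoy, hxy⟩, if_pos ⟨τ₁, h₁, τ₂, h₂, h12, hx₁, hy₂⟩]
    · rw [if_neg hocc, if_neg]
      rintro ⟨τ₁, h₁, τ₂, h₂, h12, hx₁, hy₂⟩
      exact hocc ⟨hoccOf h₁ hx₁, hoccOf h₂ hy₂,
        fun hxy => hS.hard_ne h₁ h₂ h12 (mem_hardPair_of hx₁) (mem_hardPair_of (hxy ▸ hy₂))⟩

/-- **Same-triple pairs reindexed by the triples**: `∑_{x,y∈P_H} [∃τ∈S: {x,y} = hard(τ), ordered] F(x,y)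
= ∑_{τ∈S} (F(u,a) + F(a,u))` for admissible `S`. [cite: BastiCenatiempoSchlein2021, §5.3 (case 1))] -/
theorem TripleAdm.sum_PH_sum_PH_ite_same [Fintype ι] {S : Finset (Triple e PH PS)}
    (hS : TripleAdm e S) (F : ι → ι → ℂ) :
    ∑ x ∈ PH, ∑ y ∈ PH, (if ∃ τ ∈ S, (x = τ.u ∧ y = τ.a) ∨ (x = τ.a ∧ y = τ.u) then F x y else 0) =
      ∑ τ ∈ S, (F τ.u τ.a + F τ.a τ.u) := by
  classical
  -- uniqueness of the triple: the indicator of `∃` is the sum of the indicators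
  have huniq : ∀ x y, (if ∃ τ ∈ S, (x = τ.u ∧ y = τ.a) ∨ (x = τ.a ∧ y = τ.u) then F x y else 0) =
      ∑ τ ∈ S, ((if x = τ.u ∧ y = τ.a then F x y else 0) + (if x = τ.a ∧ y = τ.u then F x y else 0)) := by
    intro x y
    by_cases hex : ∃ τ ∈ S, (x = τ.u ∧ y = τ.a) ∨ (x = τ.a ∧ y = τ.u)
    · rw [if_pos hex]
      obtain ⟨τ, hτ, hτxy⟩ := hex
      have hxτ : x = τ.u ∨ x = τ.a := by rcases hτxy with ⟨h, -⟩ | ⟨h, -⟩; exacts [Or.inl h, Or.inr h]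
      rw [← Finset.add_sum_erase S _ hτ, Finset.sum_eq_zero, add_zero]
      · have hua : τ.u ≠ τ.a := ne_of_lt τ.prop.2.2.2.2
        rcases hτxy with ⟨h1, h2⟩ | ⟨h1, h2⟩
        · rw [if_pos ⟨h1, h2⟩, if_neg, add_zero]
          rintro ⟨h3, -⟩; exact hua (h1.symm.trans h3)
        · rw [if_neg, if_pos ⟨h1, h2⟩, zero_add]
          rintro ⟨h3, -⟩; exact hua (h3.symm.trans h1)
      · intro τ' hτ'
        obtain ⟨hne, hτ'S⟩ := Finset.mem_erase.1 hτ'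
        have hnot : ¬ (x = τ'.u ∨ x = τ'.a) := fun hx' =>
          hS.hard_ne hτ'S hτ hne (mem_hardPair_of hx') (mem_hardPair_of hxτ)
        rw [if_neg (fun h => hnot (Or.inl h.1)), if_neg (fun h => hnot (Or.inr h.1)), add_zero]
    · rw [if_neg hex]
      refine (Finset.sum_eq_zero fun τ hτ => ?_).symm
      rw [if_neg (fun h => hex ⟨τ, hτ, Or.inl h⟩), if_neg (fun h => hex ⟨τ, hτ, Or.inr h⟩), add_zero]
  simp_rw [huniq]
  have hswap : ∀ x ∈ PH, ∑ y ∈ PH, ∑ τ ∈ S,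
      ((if x = τ.u ∧ y = τ.a then F x y else 0) + (if x = τ.a ∧ y = τ.u then F x y else 0)) =
      ∑ τ ∈ S, ∑ y ∈ PH,
        ((if x = τ.u ∧ y = τ.a then F x y else 0) + (if x = τ.a ∧ y = τ.u then F x y else 0)) :=
    fun x _ => Finset.sum_comm
  rw [Finset.sum_congr rfl hswap, Finset.sum_comm]
  refine Finset.sum_congr rfl fun τ hτ => ?_
  have pτ := τ.prop
  simp only [Finset.sum_add_distrib]
  congr 1
  · rw [Finset.sum_eq_single_of_mem τ.u pτ.1 (fun x _ hx => Finset.sum_eq_zero fun y _ =>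
      if_neg (fun h => hx h.1))]
    rw [Finset.sum_eq_single_of_mem τ.a pτ.2.1 (fun y _ hy => if_neg (fun h => hy h.2)), if_pos ⟨rfl, rfl⟩]
  · rw [Finset.sum_eq_single_of_mem τ.a pτ.2.1 (fun x _ hx => Finset.sum_eq_zero fun y _ =>
      if_neg (fun h => hx h.1))]
    rw [Finset.sum_eq_single_of_mem τ.u pτ.1 (fun y _ hy => if_neg (fun h => hy h.2)), if_pos ⟨rfl, rfl⟩]

/-- **A matching partner of a cross pair is a cross pair.** [cite: BastiCenatiempoSchlein2021, §5.3 (case 2))] -/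
theorem TripleAdm.cross_of_match (he : Function.Injective e) (hHS : Disjoint PH PS)
    {S S' : Finset (Triple e PH PS)} (hS : TripleAdm e S) (hS' : TripleAdm e S') {x y x' y' : ι}
    (hx : x ∈ PH) (hy : y ∈ PH) (hxy : x ≠ y)
    (hcross' : ∃ τ₁ ∈ S', ∃ τ₂ ∈ S', τ₁ ≠ τ₂ ∧ (x' = τ₁.u ∨ x' = τ₁.a) ∧ (y' = τ₂.u ∨ y' = τ₂.a))
    (h : setOcc Triple.u Triple.a Triple.b S + (Finsupp.single x' 1 + Finsupp.single y' 1) =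
      setOcc Triple.u Triple.a Triple.b S' + (Finsupp.single x 1 + Finsupp.single y 1)) :
    ∃ ρ₁ ∈ S, ∃ ρ₂ ∈ S, ρ₁ ≠ ρ₂ ∧ (x = ρ₁.u ∨ x = ρ₁.a) ∧ (y = ρ₂.u ∨ y = ρ₂.a) := by
  classical
  obtain ⟨τ₁, h₁, τ₂, h₂, h12, hx₁, hy₂⟩ := hcross'
  have hx' : x' ∈ PH := by rcases hx₁ with hh | hh <;> rw [hh]; exacts [τ₁.prop.1, τ₁.prop.2.1]
  have hy' : y' ∈ PH := by rcases hy₂ with hh | hh <;> rw [hh]; exacts [τ₂.prop.1, τ₂.prop.2.1]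
  by_cases hne : S = S'
  · subst hne
    rcases pair_eq_of_setOcc_add_eq S hxy h with ⟨e1, e2⟩ | ⟨e1, e2⟩
    · exact ⟨τ₁, h₁, τ₂, h₂, h12, e1 ▸ hx₁, e2 ▸ hy₂⟩
    · refine ⟨τ₂, h₂, τ₁, h₁, h12.symm, e2 ▸ hy₂, e1 ▸ hx₁⟩
  · obtain ⟨-, τa, τb, hab, hD, hxa, hyb⟩ :=
      hS.sdiff_eq_pair_of_cross he hHS hS' hx hy hx' hy' h h₁ h₂ h12 hx₁ hy₂ hne
    have hτaS : τa ∈ S := (Finset.mem_sdiff.1 (by rw [hD]; simp : τa ∈ S \ S')).1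
    have hτbS : τb ∈ S := (Finset.mem_sdiff.1 (by rw [hD]; simp : τb ∈ S \ S')).1
    exact ⟨τa, hτaS, τb, hτbS, hab, hxa, hyb⟩

/-- **At most four partners, summed form**: for `θ(S₀)` and a cross pair `(p₀, q₀)` of `S₀`,
`∑_S ∑_{x,y∈P_H} [θ(S), x ≠ y, d(S) + δ_{p₀} + δ_{q₀} = d(S₀) + δ_x + δ_y] ≤ 4`.
[cite: BastiCenatiempoSchlein2021, §5.3 (the term `V₂`)] -/
theorem TripleAdm.sum_partners_le_four [Fintype ι] (he : Function.Injective e)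
    (hHS : Disjoint PH PS) {S₀ : Finset (Triple e PH PS)} (hS₀ : TripleAdm e S₀) {p₀ q₀ : ι}
    (hcross : ∃ ρ₁ ∈ S₀, ∃ ρ₂ ∈ S₀, ρ₁ ≠ ρ₂ ∧ (p₀ = ρ₁.u ∨ p₀ = ρ₁.a) ∧ (q₀ = ρ₂.u ∨ q₀ = ρ₂.a)) :
    ∑ S : Finset (Triple e PH PS), ∑ x ∈ PH, ∑ y ∈ PH, (if TripleAdm e S ∧ x ≠ y ∧
        setOcc Triple.u Triple.a Triple.b S + (Finsupp.single p₀ 1 + Finsupp.single q₀ 1) =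
          setOcc Triple.u Triple.a Triple.b S₀ + (Finsupp.single x 1 + Finsupp.single y 1)
        then (1 : ℝ) else 0) ≤ 4 := by
  classical
  obtain ⟨ρ₁, h₁, ρ₂, h₂, h12, hp₀, hq₀⟩ := hcross
  set P := (Finset.univ : Finset (Finset (Triple e PH PS) × ι × ι)).filter (fun q =>
        TripleAdm e q.1 ∧ q.2.1 ∈ PH ∧ q.2.2 ∈ PH ∧ q.2.1 ≠ q.2.2 ∧
        setOcc Triple.u Triple.a Triple.b q.1 + (Finsupp.single p₀ 1 + Finsupp.single q₀ 1) =
          setOcc Triple.u Triple.a Triple.b S₀ + (Finsupp.single q.2.1 1 + Finsupp.single q.2.2 1)) with hP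
  have hcard : P.card ≤ 4 := hS₀.card_partners_le_four he hHS h₁ h₂ h12 hp₀ hq₀
  have hPsum : (P.card : ℝ) = ∑ S : Finset (Triple e PH PS), ∑ x ∈ PH, ∑ y ∈ PH,
      (if TripleAdm e S ∧ x ≠ y ∧
        setOcc Triple.u Triple.a Triple.b S + (Finsupp.single p₀ 1 + Finsupp.single q₀ 1) =
          setOcc Triple.u Triple.a Triple.b S₀ + (Finsupp.single x 1 + Finsupp.single y 1)
        then (1 : ℝ) else 0) := by
    rw [hP, Finset.card_filter, Nat.cast_sum, Fintype.sum_prod_type]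
    refine Finset.sum_congr rfl fun S _ => ?_
    rw [Fintype.sum_prod_type, ← Finset.sum_ite_mem_eq PH]
    refine Finset.sum_congr rfl fun x _ => ?_
    rw [← Finset.sum_ite_mem_eq PH]
    by_cases hx : x ∈ PH
    · rw [if_pos hx]
      refine Finset.sum_congr rfl fun y _ => ?_
      by_cases hy : y ∈ PH
      · rw [if_pos hy]
        simp only [hx, hy, true_and]
        split_ifs <;> simp
      · rw [if_neg hy, if_neg (fun h => hy h.2.2.1)]; simp
    · rw [if_neg hx]
      refine Finset.sum_eq_zero fun y _ => ?_
      rw [if_neg (fun h => hx h.2.1)]; simp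
  rw [← hPsum]
  exact_mod_cast hcard

/-- The number of occupied hard modes of an admissible set is `2|S|`. [folklore] -/
theorem TripleAdm.sum_PH_ite_occupied [Fintype ι] (hHS : Disjoint PH PS) {S : Finset (Triple e PH PS)}
    (hS : TripleAdm e S) :
    ∑ x ∈ PH, (if setOcc Triple.u Triple.a Triple.b S x ≠ 0 then (1 : ℝ) else 0) = 2 * S.card := by
  classical
  have h := hS.sum_ite_hard_occupied hHS (fun _ => (1 : ℂ))
  have h' : ∑ x, (if x ∈ PH ∧ setOcc Triple.u Triple.a Triple.b S x ≠ 0 then (1 : ℝ) else 0) = 2 * S.card := by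
    have h2 : ((∑ x, (if x ∈ PH ∧ setOcc Triple.u Triple.a Triple.b S x ≠ 0 then (1 : ℝ) else 0) : ℝ) : ℂ) =
        ((2 * S.card : ℝ) : ℂ) := by
      rw [Complex.ofReal_sum]
      have hc : ∀ x, (((if x ∈ PH ∧ setOcc Triple.u Triple.a Triple.b S x ≠ 0 then (1 : ℝ) else 0) : ℝ) : ℂ) =
          (if x ∈ PH ∧ setOcc Triple.u Triple.a Triple.b S x ≠ 0 then (1 : ℂ) else 0) := by
        intro x; split_ifs <;> simp
      simp_rw [hc, h, Finset.sum_const, nsmul_eq_mul]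
      push_cast; ring
    exact_mod_cast h2
  rw [← h', ← Finset.sum_ite_mem_eq PH]
  refine Finset.sum_congr rfl fun x _ => ?_
  by_cases hx : x ∈ PH <;> simp [hx]

end TypeBCount

/-! ### The quartic pairing decomposition `⟨ξ_ν, 𝒱ξ_ν⟩ = V₁ (Type A, freed) + B (Type B, bounded)` -/

section QuarticGlue

omit [DecidableEq ι] [LinearOrder ι] in
/-- Reordering five sums with fixed ranges. [folklore] -/
theorem sum_comm₂₂₁ {α β γ M : Type*} [AddCommMonoid M] (A : Finset α) (C : Finset β) (E : Finset γ)
    (f : α → α → β → β → γ → M) :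
    ∑ x ∈ A, ∑ y ∈ A, ∑ x' ∈ C, ∑ y' ∈ C, ∑ S ∈ E, f x y x' y' S =
      ∑ S ∈ E, ∑ x' ∈ C, ∑ y' ∈ C, ∑ x ∈ A, ∑ y ∈ A, f x y x' y' S := by
  calc ∑ x ∈ A, ∑ y ∈ A, ∑ x' ∈ C, ∑ y' ∈ C, ∑ S ∈ E, f x y x' y' S
      = ∑ p ∈ A ×ˢ A, ∑ q ∈ C ×ˢ C, ∑ S ∈ E, f p.1 p.2 q.1 q.2 S := by
        simp only [Finset.sum_product]
    _ = ∑ q ∈ C ×ˢ C, ∑ S ∈ E, ∑ p ∈ A ×ˢ A, f p.1 p.2 q.1 q.2 S := by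
        rw [Finset.sum_comm]
        exact Finset.sum_congr rfl fun q _ => Finset.sum_comm
    _ = ∑ S ∈ E, ∑ q ∈ C ×ˢ C, ∑ p ∈ A ×ˢ A, f p.1 p.2 q.1 q.2 S := Finset.sum_comm
    _ = _ := by
        simp only [Finset.sum_product]

omit [DecidableEq ι] [LinearOrder ι] in
/-- Swapping two blocks of three sums with fixed ranges. [folklore] -/
theorem sum_comm₃₃ {α γ M : Type*} [AddCommMonoid M] (A : Finset α) (E : Finset γ)
    (f : γ → α → α → γ → α → α → M) :
    ∑ S' ∈ E, ∑ x' ∈ A, ∑ y' ∈ A, ∑ S ∈ E, ∑ x ∈ A, ∑ y ∈ A, f S' x' y' S x y =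
      ∑ S ∈ E, ∑ x ∈ A, ∑ y ∈ A, ∑ S' ∈ E, ∑ x' ∈ A, ∑ y' ∈ A, f S' x' y' S x y := by
  have h3 : ∀ (g : γ → α → α → M), ∑ S ∈ E, ∑ x ∈ A, ∑ y ∈ A, g S x y =
      ∑ t ∈ E ×ˢ A ×ˢ A, g t.1 t.2.1 t.2.2 := by
    intro g
    simp only [Finset.sum_product]
  calc ∑ S' ∈ E, ∑ x' ∈ A, ∑ y' ∈ A, ∑ S ∈ E, ∑ x ∈ A, ∑ y ∈ A, f S' x' y' S x y
      = ∑ t ∈ E ×ˢ A ×ˢ A, ∑ t₁ ∈ E ×ˢ A ×ˢ A, f t.1 t.2.1 t.2.2 t₁.1 t₁.2.1 t₁.2.2 := by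
        rw [h3 (fun S' x' y' => ∑ S ∈ E, ∑ x ∈ A, ∑ y ∈ A, f S' x' y' S x y)]
        exact Finset.sum_congr rfl fun t _ => h3 _
    _ = ∑ t₁ ∈ E ×ˢ A ×ˢ A, ∑ t ∈ E ×ˢ A ×ˢ A, f t.1 t.2.1 t.2.2 t₁.1 t₁.2.1 t₁.2.2 := Finset.sum_comm
    _ = _ := by
        rw [h3 (fun S x y => ∑ S' ∈ E, ∑ x' ∈ A, ∑ y' ∈ A, f S' x' y' S x y)]
        exact Finset.sum_congr rfl fun t₁ _ => (h3 (fun S' x' y' => f S' x' y' t₁.1 t₁.2.1 t₁.2.2)).symm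

/-- **`a_{y'}a_{x'}ξ_ν` expanded over the admissible sets** (hard or arbitrary `x', y'`).
[cite: BastiCenatiempoSchlein2021, §5.3 (5.12)] -/
theorem pderiv_pderiv_cubicVector_eq_sum [Fintype ι] (hHS : Disjoint PH PS) (κ : Triple e PH PS → ℂ)
    (x' y' : ι) :
    pderiv y' (pderiv x' (cubicVector e PH PS κ)) =
      ∑ S' : Finset (Triple e PH PS), (if TripleAdm e S' ∧ (setOcc Triple.u Triple.a Triple.b S' x' ≠ 0 ∧
          setOcc Triple.u Triple.a Triple.b S' y' ≠ 0 ∧ x' ≠ y') then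
        monomial (setOcc Triple.u Triple.a Triple.b S' - Finsupp.single x' 1 - Finsupp.single y' 1)
          (setCoeff κ (TripleAdm e) S') else 0) := by
  classical
  unfold cubicVector setVector
  simp only [map_sum]
  refine Finset.sum_congr rfl fun S' _ => ?_
  by_cases hA : TripleAdm e S'
  · rw [hA.pderiv_pderiv_monomial_setOcc hHS]
    simp only [hA, true_and]
  · rw [setCoeff_of_not hA, if_neg (fun h => hA h.1)]
    simp

/-- **Expanding the right factor and sorting the annihilated pair** (cases 1)/2) of
[BastiCenatiempoSchlein2021, §5.3]): with
`F(S',x',y') = ∑_{x,y∈P_H} K(x,y,x',y') ⟨a_ya_xξ_ν, c_{S'}X^{d(S')-δ_{x'}-δ_{y'}}⟩`,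
`∑_{x,y,x',y'∈P_H} K ⟨a_ya_xξ_ν, a_{y'}a_{x'}ξ_ν⟩ = ∑_{θ(S')} ∑_{τ'∈S'} (F(S',u',a') + F(S',a',u'))
  + ∑_{S'} ∑_{x',y'∈P_H} [θ(S'), (x',y') hard slots of two different triples of S'] F(S',x',y')`.
[cite: BastiCenatiempoSchlein2021, §5.3 (5.12), cases 1) and 2)] -/
theorem quartic_sum_eq_same_add_cross [Fintype ι] (hHS : Disjoint PH PS) (κ : Triple e PH PS → ℂ)
    (K : ι → ι → ι → ι → ℂ) :
    ∑ x ∈ PH, ∑ y ∈ PH, ∑ x' ∈ PH, ∑ y' ∈ PH, K x y x' y' *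
        fockInner (pderiv y (pderiv x (cubicVector e PH PS κ))) (pderiv y' (pderiv x' (cubicVector e PH PS κ))) =
      (∑ S' : Finset (Triple e PH PS), (if TripleAdm e S' then ∑ τ' ∈ S',
        ((∑ x ∈ PH, ∑ y ∈ PH, K x y τ'.u τ'.a * fockInner (pderiv y (pderiv x (cubicVector e PH PS κ)))
            (monomial (setOcc Triple.u Triple.a Triple.b S' - Finsupp.single τ'.u 1 - Finsupp.single τ'.a 1)
              (setCoeff κ (TripleAdm e) S'))) +
         (∑ x ∈ PH, ∑ y ∈ PH, K x y τ'.a τ'.u * fockInner (pderiv y (pderiv x (cubicVector e PH PS κ)))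
            (monomial (setOcc Triple.u Triple.a Triple.b S' - Finsupp.single τ'.a 1 - Finsupp.single τ'.u 1)
              (setCoeff κ (TripleAdm e) S')))) else 0)) +
      ∑ S' : Finset (Triple e PH PS), ∑ x' ∈ PH, ∑ y' ∈ PH,
        (if TripleAdm e S' ∧ (∃ τ₁ ∈ S', ∃ τ₂ ∈ S', τ₁ ≠ τ₂ ∧ (x' = τ₁.u ∨ x' = τ₁.a) ∧ (y' = τ₂.u ∨ y' = τ₂.a))
         then ∑ x ∈ PH, ∑ y ∈ PH, K x y x' y' * fockInner (pderiv y (pderiv x (cubicVector e PH PS κ)))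
            (monomial (setOcc Triple.u Triple.a Triple.b S' - Finsupp.single x' 1 - Finsupp.single y' 1)
              (setCoeff κ (TripleAdm e) S')) else 0) := by
  classical
  set ξ := cubicVector e PH PS κ with hξ
  set F : Finset (Triple e PH PS) → ι → ι → ℂ := fun S' x' y' =>
    ∑ x ∈ PH, ∑ y ∈ PH, K x y x' y' * fockInner (pderiv y (pderiv x ξ))
      (monomial (setOcc Triple.u Triple.a Triple.b S' - Finsupp.single x' 1 - Finsupp.single y' 1)
        (setCoeff κ (TripleAdm e) S')) with hF
  -- expand the right factor
  have hexp : ∀ x y x' y', K x y x' y' * fockInner (pderiv y (pderiv x ξ)) (pderiv y' (pderiv x' ξ)) =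
      ∑ S' : Finset (Triple e PH PS), (if TripleAdm e S' ∧ (setOcc Triple.u Triple.a Triple.b S' x' ≠ 0 ∧
          setOcc Triple.u Triple.a Triple.b S' y' ≠ 0 ∧ x' ≠ y') then
        K x y x' y' * fockInner (pderiv y (pderiv x ξ))
          (monomial (setOcc Triple.u Triple.a Triple.b S' - Finsupp.single x' 1 - Finsupp.single y' 1)
            (setCoeff κ (TripleAdm e) S')) else 0) := by
    intro x y x' y'
    rw [hξ, pderiv_pderiv_cubicVector_eq_sum hHS κ x' y', fockInner_sum_right, Finset.mul_sum]
    refine Finset.sum_congr rfl fun S' _ => ?_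
    rw [fockInner_ite_right, mul_ite, mul_zero]
  simp_rw [hexp]
  rw [sum_comm₂₂₁, ← Finset.sum_add_distrib]
  refine Finset.sum_congr rfl fun S' _ => ?_
  by_cases hA : TripleAdm e S'
  · -- pull the indicator out of the `x, y` sums and split it into same-triple and cross pairs
    have hin : ∀ x' ∈ PH, ∀ y' ∈ PH, ∑ x ∈ PH, ∑ y ∈ PH,
        (if TripleAdm e S' ∧ (setOcc Triple.u Triple.a Triple.b S' x' ≠ 0 ∧
            setOcc Triple.u Triple.a Triple.b S' y' ≠ 0 ∧ x' ≠ y') then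
          K x y x' y' * fockInner (pderiv y (pderiv x ξ))
            (monomial (setOcc Triple.u Triple.a Triple.b S' - Finsupp.single x' 1 - Finsupp.single y' 1)
              (setCoeff κ (TripleAdm e) S')) else 0) =
        (if ∃ τ ∈ S', (x' = τ.u ∧ y' = τ.a) ∨ (x' = τ.a ∧ y' = τ.u) then F S' x' y' else 0) +
        (if ∃ τ₁ ∈ S', ∃ τ₂ ∈ S', τ₁ ≠ τ₂ ∧ (x' = τ₁.u ∨ x' = τ₁.a) ∧ (y' = τ₂.u ∨ y' = τ₂.a)
          then F S' x' y' else 0) := by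
      intro x' hx' y' hy'
      simp only [hA, true_and]
      rw [Finset.sum_congr rfl fun x _ => Finset.sum_ite_irrel _ _ _ _, Finset.sum_ite_irrel,
        Finset.sum_const_zero]
      simp_rw [Finset.sum_const_zero]
      exact hA.ite_occupied_ne_eq hHS hx' hy' (F S' x' y')
    rw [Finset.sum_congr rfl fun x' hx' => Finset.sum_congr rfl fun y' hy' => hin x' hx' y' hy',
      if_pos hA]
    conv_lhs => simp only [Finset.sum_add_distrib]
    congr 1
    · rw [hA.sum_PH_sum_PH_ite_same (F S')]
    · refine Finset.sum_congr rfl fun x' _ => Finset.sum_congr rfl fun y' _ => ?_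
      simp only [hA, true_and]
      rfl
  · rw [if_neg hA, zero_add]
    refine Finset.sum_congr rfl fun x' _ => Finset.sum_congr rfl fun y' _ => ?_
    rw [if_neg (fun h => hA h.1)]
    refine Finset.sum_eq_zero fun x _ => Finset.sum_eq_zero fun y _ => ?_
    rw [if_neg (fun h => hA h.1)]

/-- **The same-triple part is the Type-A pairing `V₁`, freed**: with
`K̃(τ,τ') = K(u,a,u',a') + K(u,a,a',u') + K(a,u,u',a') + K(a,u,a',u')`, the same-triple part of
`quartic_sum_eq_same_add_cross` equals `∑_{τ',τ : b=b'} κ_{τ'} conj(κ_τ) K̃(τ,τ') (‖ξ_ν‖² - D₂(τ',τ))`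
(`sum_typeA_eq`, `sum_typeA_freed`). [cite: BastiCenatiempoSchlein2021, §5.3 (5.13)–(5.14)] -/
theorem quartic_same_eq_typeA_freed [Fintype ι] (hHS : Disjoint PH PS) (κ : Triple e PH PS → ℂ)
    (K : ι → ι → ι → ι → ℂ) :
    (∑ S' : Finset (Triple e PH PS), (if TripleAdm e S' then ∑ τ' ∈ S',
        ((∑ x ∈ PH, ∑ y ∈ PH, K x y τ'.u τ'.a * fockInner (pderiv y (pderiv x (cubicVector e PH PS κ)))
            (monomial (setOcc Triple.u Triple.a Triple.b S' - Finsupp.single τ'.u 1 - Finsupp.single τ'.a 1)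
              (setCoeff κ (TripleAdm e) S'))) +
         (∑ x ∈ PH, ∑ y ∈ PH, K x y τ'.a τ'.u * fockInner (pderiv y (pderiv x (cubicVector e PH PS κ)))
            (monomial (setOcc Triple.u Triple.a Triple.b S' - Finsupp.single τ'.a 1 - Finsupp.single τ'.u 1)
              (setCoeff κ (TripleAdm e) S')))) else 0)) =
      ∑ τ' : Triple e PH PS, ∑ τ : Triple e PH PS, (if τ.b = τ'.b then
        κ τ' * conj (κ τ) * (K τ.u τ.a τ'.u τ'.a + K τ.u τ.a τ'.a τ'.u + K τ.a τ.u τ'.u τ'.a + K τ.a τ.u τ'.a τ'.u) *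
          (((∑ R : Finset (Triple e PH PS), ‖setCoeff κ (TripleAdm e) R‖ ^ 2 : ℝ) : ℂ) -
            ((∑ R : Finset (Triple e PH PS),
              (if ¬ (τ' ∉ R ∧ τ ∉ R ∧ TripleAdm e (insert τ' R) ∧ TripleAdm e (insert τ R)) then
                ‖setCoeff κ (TripleAdm e) R‖ ^ 2 else 0) : ℝ) : ℂ)) else 0) := by
  classical
  set Kt : Triple e PH PS → Triple e PH PS → ℂ := fun τ τ' =>
    K τ.u τ.a τ'.u τ'.a + K τ.u τ.a τ'.a τ'.u + K τ.a τ.u τ'.u τ'.a + K τ.a τ.u τ'.a τ'.u with hKt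
  rw [show (∑ τ' : Triple e PH PS, ∑ τ : Triple e PH PS, (if τ.b = τ'.b then
        κ τ' * conj (κ τ) * (K τ.u τ.a τ'.u τ'.a + K τ.u τ.a τ'.a τ'.u + K τ.a τ.u τ'.u τ'.a + K τ.a τ.u τ'.a τ'.u) *
          (((∑ R : Finset (Triple e PH PS), ‖setCoeff κ (TripleAdm e) R‖ ^ 2 : ℝ) : ℂ) -
            ((∑ R : Finset (Triple e PH PS),
              (if ¬ (τ' ∉ R ∧ τ ∉ R ∧ TripleAdm e (insert τ' R) ∧ TripleAdm e (insert τ R)) then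
                ‖setCoeff κ (TripleAdm e) R‖ ^ 2 else 0) : ℝ) : ℂ)) else 0)) =
      ∑ τ' : Triple e PH PS, ∑ τ : Triple e PH PS, (if τ.b = τ'.b then κ τ' * conj (κ τ) * Kt τ τ' *
          (((∑ R : Finset (Triple e PH PS), ‖setCoeff κ (TripleAdm e) R‖ ^ 2 : ℝ) : ℂ) -
            ((∑ R : Finset (Triple e PH PS),
              (if ¬ (τ' ∉ R ∧ τ ∉ R ∧ TripleAdm e (insert τ' R) ∧ TripleAdm e (insert τ R)) then
                ‖setCoeff κ (TripleAdm e) R‖ ^ 2 else 0) : ℝ) : ℂ)) else 0) from rfl,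
    ← sum_typeA_freed κ Kt, ← sum_typeA_eq κ Kt]
  refine Finset.sum_congr rfl fun S' _ => ?_
  by_cases hA : TripleAdm e S'
  · rw [if_pos hA]
    refine Finset.sum_congr rfl fun τ' hτ' => ?_
    have hexp1 : setOcc Triple.u Triple.a Triple.b S' - Finsupp.single τ'.u 1 - Finsupp.single τ'.a 1 =
        setOcc Triple.u Triple.a Triple.b (S'.erase τ') + Finsupp.single τ'.b 1 := setOcc_sub_hardPair hτ'
    have hexp2 : setOcc Triple.u Triple.a Triple.b S' - Finsupp.single τ'.a 1 - Finsupp.single τ'.u 1 =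
        setOcc Triple.u Triple.a Triple.b (S'.erase τ') + Finsupp.single τ'.b 1 := by
      rw [tsub_right_comm]; exact setOcc_sub_hardPair hτ'
    have hmono : (monomial (setOcc Triple.u Triple.a Triple.b (S'.erase τ') + Finsupp.single τ'.b 1)
        (setCoeff κ (TripleAdm e) S') : MvPolynomial ι ℂ) =
        setCoeff κ (TripleAdm e) S' •
          monomial (setOcc Triple.u Triple.a Triple.b (S'.erase τ') + Finsupp.single τ'.b 1) (1 : ℂ) := by
      rw [smul_monomial, smul_eq_mul, mul_one]
    rw [hexp1, hexp2, hmono]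
    simp only [fockInner_smul_right]
    have key := sum_sum_mul_fockInner_pderiv_pderiv_cubicVector_monomial hHS κ (hA.erase τ') τ'.prop.2.2.1
      (fun x y => K x y τ'.u τ'.a + K x y τ'.a τ'.u)
    calc (∑ x ∈ PH, ∑ y ∈ PH, K x y τ'.u τ'.a * (setCoeff κ (TripleAdm e) S' *
            fockInner (pderiv y (pderiv x (cubicVector e PH PS κ)))
              (monomial (setOcc Triple.u Triple.a Triple.b (S'.erase τ') + Finsupp.single τ'.b 1) 1))) +
          (∑ x ∈ PH, ∑ y ∈ PH, K x y τ'.a τ'.u * (setCoeff κ (TripleAdm e) S' *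
            fockInner (pderiv y (pderiv x (cubicVector e PH PS κ)))
              (monomial (setOcc Triple.u Triple.a Triple.b (S'.erase τ') + Finsupp.single τ'.b 1) 1)))
        = setCoeff κ (TripleAdm e) S' * ∑ x ∈ PH, ∑ y ∈ PH, (K x y τ'.u τ'.a + K x y τ'.a τ'.u) *
            fockInner (pderiv y (pderiv x (cubicVector e PH PS κ)))
              (monomial (setOcc Triple.u Triple.a Triple.b (S'.erase τ') + Finsupp.single τ'.b 1) 1) := by
          rw [← Finset.sum_add_distrib, Finset.mul_sum]
          refine Finset.sum_congr rfl fun x _ => ?_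
          rw [← Finset.sum_add_distrib, Finset.mul_sum]
          refine Finset.sum_congr rfl fun y _ => ?_
          ring
      _ = _ := by
          rw [key]
          congr 1
          refine Finset.sum_congr rfl fun τ _ => ?_
          split_ifs
          all_goals first | rfl | (simp only [hKt]; ring)
  · rw [if_neg hA]
    refine (Finset.sum_eq_zero fun τ' _ => ?_).symm
    rw [setCoeff_of_not hA, zero_mul]

/-- **`⟨a_ya_xξ_ν, c' X^{m}⟩` for a squarefree `m`, expanded over the admissible sets.**
[cite: BastiCenatiempoSchlein2021, §5.3 (5.12)] -/
theorem fockInner_pderiv_pderiv_cubicVector_monomial_eq_sum [Fintype ι] (hHS : Disjoint PH PS)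
    (κ : Triple e PH PS → ℂ) (x y : ι) {m : ι →₀ ℕ} (hm : ∀ i, m i ≤ 1) (c' : ℂ) :
    fockInner (pderiv y (pderiv x (cubicVector e PH PS κ))) (monomial m c') =
      ∑ S : Finset (Triple e PH PS), (if TripleAdm e S ∧ setOcc Triple.u Triple.a Triple.b S x ≠ 0 ∧
          setOcc Triple.u Triple.a Triple.b S y ≠ 0 ∧ x ≠ y ∧
          setOcc Triple.u Triple.a Triple.b S - Finsupp.single x 1 - Finsupp.single y 1 = m then
        conj (setCoeff κ (TripleAdm e) S) * c' else 0) := by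
  classical
  unfold cubicVector setVector
  simp only [map_sum]
  rw [fockInner_sum_left]
  refine Finset.sum_congr rfl fun S _ => ?_
  by_cases hA : TripleAdm e S
  · rw [hA.pderiv_pderiv_monomial_setOcc hHS, fockInner_ite_left, fockInner_monomial]
    by_cases hC : setOcc Triple.u Triple.a Triple.b S x ≠ 0 ∧ setOcc Triple.u Triple.a Triple.b S y ≠ 0 ∧ x ≠ y
    · rw [if_pos hC]
      by_cases hE : setOcc Triple.u Triple.a Triple.b S - Finsupp.single x 1 - Finsupp.single y 1 = m
      · rw [if_pos hE, if_pos ⟨hA, hC.1, hC.2.1, hC.2.2, hE⟩, hE, occFactorial_eq_one_of_le_one hm,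
          Nat.cast_one, one_mul]
      · rw [if_neg hE, if_neg (fun h => hE h.2.2.2.2)]
    · rw [if_neg hC, if_neg (fun h => hC ⟨h.2.1, h.2.2.1, h.2.2.2.1⟩)]
  · rw [setCoeff_of_not hA, if_neg (fun h => hA h.1)]
    simp [fockInner_zero_left]

/-- From the annihilated-exponent equality to the matching condition (occupied, distinct modes).
[folklore] -/
theorem TripleAdm.match_of_exp {S S' : Finset (Triple e PH PS)} (hS' : TripleAdm e S') {x y x' y' : ι}
    (hox : setOcc Triple.u Triple.a Triple.b S x ≠ 0) (hoy : setOcc Triple.u Triple.a Triple.b S y ≠ 0)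
    (hxy : x ≠ y)
    (hcross' : ∃ τ₁ ∈ S', ∃ τ₂ ∈ S', τ₁ ≠ τ₂ ∧ (x' = τ₁.u ∨ x' = τ₁.a) ∧ (y' = τ₂.u ∨ y' = τ₂.a))
    (hE : setOcc Triple.u Triple.a Triple.b S - Finsupp.single x 1 - Finsupp.single y 1 =
      setOcc Triple.u Triple.a Triple.b S' - Finsupp.single x' 1 - Finsupp.single y' 1) :
    setOcc Triple.u Triple.a Triple.b S + (Finsupp.single x' 1 + Finsupp.single y' 1) =
      setOcc Triple.u Triple.a Triple.b S' + (Finsupp.single x 1 + Finsupp.single y 1) := by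
  classical
  obtain ⟨τ₁, h₁, τ₂, h₂, h12, hx₁, hy₂⟩ := hcross'
  have hox' : setOcc Triple.u Triple.a Triple.b S' x' ≠ 0 := by
    rcases hx₁ with hh | hh <;> rw [hh]
    exacts [(setOcc_slot_ne_zero h₁).1, (setOcc_slot_ne_zero h₁).2.1]
  have hoy' : setOcc Triple.u Triple.a Triple.b S' y' ≠ 0 := by
    rcases hy₂ with hh | hh <;> rw [hh]
    exacts [(setOcc_slot_ne_zero h₂).1, (setOcc_slot_ne_zero h₂).2.1]
  have hxy' : x' ≠ y' := by
    intro hh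
    have hx₂ : x' = τ₂.u ∨ x' = τ₂.a := by rw [hh]; exact hy₂
    exact hS'.hard_ne h₁ h₂ h12 (mem_hardPair_of hx₁) (mem_hardPair_of hx₂)
  exact (tsub_tsub_eq_iff_add_add hxy (Nat.one_le_iff_ne_zero.2 hox) (Nat.one_le_iff_ne_zero.2 hoy) hxy'
    (Nat.one_le_iff_ne_zero.2 hox') (Nat.one_le_iff_ne_zero.2 hoy')).1 hE

/-- **Row count** (fixed cross pair on the right): at most four `(S, x, y)`.
[cite: BastiCenatiempoSchlein2021, §5.3 (`V₂`)] -/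
theorem TripleAdm.sum_exp_partners_le_four [Fintype ι] (he : Function.Injective e) (hHS : Disjoint PH PS)
    {S' : Finset (Triple e PH PS)} (hS' : TripleAdm e S') {x' y' : ι}
    (hcross' : ∃ τ₁ ∈ S', ∃ τ₂ ∈ S', τ₁ ≠ τ₂ ∧ (x' = τ₁.u ∨ x' = τ₁.a) ∧ (y' = τ₂.u ∨ y' = τ₂.a)) :
    ∑ S : Finset (Triple e PH PS), ∑ x ∈ PH, ∑ y ∈ PH, (if TripleAdm e S ∧
        setOcc Triple.u Triple.a Triple.b S x ≠ 0 ∧ setOcc Triple.u Triple.a Triple.b S y ≠ 0 ∧ x ≠ y ∧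
        setOcc Triple.u Triple.a Triple.b S - Finsupp.single x 1 - Finsupp.single y 1 =
          setOcc Triple.u Triple.a Triple.b S' - Finsupp.single x' 1 - Finsupp.single y' 1
        then (1 : ℝ) else 0) ≤ 4 := by
  classical
  refine le_trans (Finset.sum_le_sum fun S _ => Finset.sum_le_sum fun x _ => Finset.sum_le_sum fun y _ => ?_)
    (hS'.sum_partners_le_four he hHS hcross')
  split_ifs with h1 h2
  · exact le_rfl
  · exact absurd ⟨h1.1, h1.2.2.2.1, hS'.match_of_exp h1.2.1 h1.2.2.1 h1.2.2.2.1 hcross' h1.2.2.2.2⟩ h2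
  · norm_num
  · exact le_rfl

/-- **Column count** (fixed created pair on the left): at most four `(S', x', y')`, and none unless
`x, y` are occupied in an admissible `S`. [cite: BastiCenatiempoSchlein2021, §5.3 (`V₂`)] -/
theorem TripleAdm.sum_exp_partners_le_four' [Fintype ι] (he : Function.Injective e) (hHS : Disjoint PH PS)
    (S : Finset (Triple e PH PS)) {x y : ι} (hx : x ∈ PH) (hy : y ∈ PH) :
    ∑ S' : Finset (Triple e PH PS), ∑ x' ∈ PH, ∑ y' ∈ PH, (if (TripleAdm e S' ∧
        (∃ τ₁ ∈ S', ∃ τ₂ ∈ S', τ₁ ≠ τ₂ ∧ (x' = τ₁.u ∨ x' = τ₁.a) ∧ (y' = τ₂.u ∨ y' = τ₂.a))) ∧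
        (TripleAdm e S ∧ setOcc Triple.u Triple.a Triple.b S x ≠ 0 ∧ setOcc Triple.u Triple.a Triple.b S y ≠ 0 ∧
          x ≠ y ∧ setOcc Triple.u Triple.a Triple.b S - Finsupp.single x 1 - Finsupp.single y 1 =
            setOcc Triple.u Triple.a Triple.b S' - Finsupp.single x' 1 - Finsupp.single y' 1)
        then (1 : ℝ) else 0) ≤
      4 * (if TripleAdm e S ∧ setOcc Triple.u Triple.a Triple.b S x ≠ 0 ∧ setOcc Triple.u Triple.a Triple.b S y ≠ 0
        then (1 : ℝ) else 0) := by
  classical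
  by_cases hC : TripleAdm e S ∧ setOcc Triple.u Triple.a Triple.b S x ≠ 0 ∧ setOcc Triple.u Triple.a Triple.b S y ≠ 0
  · rw [if_pos hC, mul_one]
    obtain ⟨hS, hox, hoy⟩ := hC
    by_cases hcr : ∃ ρ₁ ∈ S, ∃ ρ₂ ∈ S, ρ₁ ≠ ρ₂ ∧ (x = ρ₁.u ∨ x = ρ₁.a) ∧ (y = ρ₂.u ∨ y = ρ₂.a)
    · refine le_trans (Finset.sum_le_sum fun S' _ => Finset.sum_le_sum fun x' _ =>
        Finset.sum_le_sum fun y' _ => ?_) (hS.sum_partners_le_four he hHS hcr)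
      split_ifs with h1 h2
      · exact le_rfl
      · exfalso
        obtain ⟨⟨hS', hcross'⟩, -, -, -, hxy, hE⟩ := h1
        obtain ⟨τ₁, h₁, τ₂, h₂, h12, hx₁, hy₂⟩ := hcross'
        have hxy' : x' ≠ y' := by
          intro hh
          have hx₂ : x' = τ₂.u ∨ x' = τ₂.a := by rw [hh]; exact hy₂
          exact hS'.hard_ne h₁ h₂ h12 (mem_hardPair_of hx₁) (mem_hardPair_of hx₂)
        exact h2 ⟨hS', hxy', (hS'.match_of_exp hox hoy hxy ⟨τ₁, h₁, τ₂, h₂, h12, hx₁, hy₂⟩ hE).symm⟩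
      · norm_num
      · exact le_rfl
    · -- no partner at all
      have h0 : ∀ S' : Finset (Triple e PH PS), ∀ x' ∈ PH, ∀ y' ∈ PH, (if (TripleAdm e S' ∧
          (∃ τ₁ ∈ S', ∃ τ₂ ∈ S', τ₁ ≠ τ₂ ∧ (x' = τ₁.u ∨ x' = τ₁.a) ∧ (y' = τ₂.u ∨ y' = τ₂.a))) ∧
          (TripleAdm e S ∧ setOcc Triple.u Triple.a Triple.b S x ≠ 0 ∧ setOcc Triple.u Triple.a Triple.b S y ≠ 0 ∧
            x ≠ y ∧ setOcc Triple.u Triple.a Triple.b S - Finsupp.single x 1 - Finsupp.single y 1 =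
              setOcc Triple.u Triple.a Triple.b S' - Finsupp.single x' 1 - Finsupp.single y' 1)
          then (1 : ℝ) else 0) = 0 := by
        intro S' x' _ y' _
        rw [if_neg]
        rintro ⟨⟨hS', hcross'⟩, -, -, -, hxy, hE⟩
        exact hcr (hS.cross_of_match he hHS hS' hx hy hxy hcross' (hS'.match_of_exp hox hoy hxy hcross' hE))
      rw [Finset.sum_eq_zero fun S' _ => Finset.sum_eq_zero fun x' hx' => Finset.sum_eq_zero fun y' hy' =>
        h0 S' x' hx' y' hy']
      norm_num
  · rw [if_neg hC, mul_zero]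
    refine le_of_eq (Finset.sum_eq_zero fun S' _ => Finset.sum_eq_zero fun x' _ =>
      Finset.sum_eq_zero fun y' _ => if_neg ?_)
    rintro ⟨-, hS, hox, hoy, -⟩
    exact hC ⟨hS, hox, hoy⟩

/-- The number of ordered pairs of occupied hard modes is `(2|S|)²`. [folklore] -/
theorem TripleAdm.sum_PH_sum_PH_ite_occupied [Fintype ι] (hHS : Disjoint PH PS)
    {S : Finset (Triple e PH PS)} (hS : TripleAdm e S) :
    ∑ x ∈ PH, ∑ y ∈ PH, (if setOcc Triple.u Triple.a Triple.b S x ≠ 0 ∧ setOcc Triple.u Triple.a Triple.b S y ≠ 0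
      then (1 : ℝ) else 0) = (2 * S.card) ^ 2 := by
  classical
  have h1 := hS.sum_PH_ite_occupied hHS
  have hprod : ∀ x y, (if setOcc Triple.u Triple.a Triple.b S x ≠ 0 ∧ setOcc Triple.u Triple.a Triple.b S y ≠ 0
      then (1 : ℝ) else 0) = (if setOcc Triple.u Triple.a Triple.b S x ≠ 0 then (1 : ℝ) else 0) *
        (if setOcc Triple.u Triple.a Triple.b S y ≠ 0 then (1 : ℝ) else 0) := by
    intro x y; split_ifs <;> simp_all
  simp_rw [hprod, ← Finset.mul_sum, ← Finset.sum_mul, h1]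
  ring

/-- **The Type-B part is an error term**: with `|K| ≤ K₀`,
`|B| ≤ 16 K₀ ∑_S |c_S|² |S|²` (`≤ 16K₀((∑|κ|²)² + ∑|κ|²)‖ξ_ν‖²` by the moment bounds) — the finitely
many re-pairings of two triples, bounded by `|c_Sc_{S'}| ≤ (|c_S|²+|c_{S'}|²)/2` and the partner
counts. [cite: BastiCenatiempoSchlein2021, §5.3 (the bound for `V₂`, (5.19))] -/
theorem norm_quartic_cross_le [Fintype ι] (he : Function.Injective e) (hHS : Disjoint PH PS)
    (κ : Triple e PH PS → ℂ) (K : ι → ι → ι → ι → ℂ) {K₀ : ℝ} (hK₀ : 0 ≤ K₀)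
    (hK : ∀ x y x' y', ‖K x y x' y'‖ ≤ K₀) :
    ‖∑ S' : Finset (Triple e PH PS), ∑ x' ∈ PH, ∑ y' ∈ PH,
        (if TripleAdm e S' ∧ (∃ τ₁ ∈ S', ∃ τ₂ ∈ S', τ₁ ≠ τ₂ ∧ (x' = τ₁.u ∨ x' = τ₁.a) ∧ (y' = τ₂.u ∨ y' = τ₂.a))
         then ∑ x ∈ PH, ∑ y ∈ PH, K x y x' y' * fockInner (pderiv y (pderiv x (cubicVector e PH PS κ)))
            (monomial (setOcc Triple.u Triple.a Triple.b S' - Finsupp.single x' 1 - Finsupp.single y' 1)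
              (setCoeff κ (TripleAdm e) S')) else 0)‖ ≤
      16 * K₀ * ∑ S : Finset (Triple e PH PS), ‖setCoeff κ (TripleAdm e) S‖ ^ 2 * (S.card : ℝ) ^ 2 := by
  classical
  -- abbreviations
  set c : Finset (Triple e PH PS) → ℂ := fun S => setCoeff κ (TripleAdm e) S with hc
  set A' : Finset (Triple e PH PS) → ι → ι → Prop := fun S' x' y' => TripleAdm e S' ∧
    (∃ τ₁ ∈ S', ∃ τ₂ ∈ S', τ₁ ≠ τ₂ ∧ (x' = τ₁.u ∨ x' = τ₁.a) ∧ (y' = τ₂.u ∨ y' = τ₂.a)) with hA'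
  set C : Finset (Triple e PH PS) → ι → ι → Finset (Triple e PH PS) → ι → ι → Prop :=
    fun S x y S' x' y' => TripleAdm e S ∧ setOcc Triple.u Triple.a Triple.b S x ≠ 0 ∧
      setOcc Triple.u Triple.a Triple.b S y ≠ 0 ∧ x ≠ y ∧
      setOcc Triple.u Triple.a Triple.b S - Finsupp.single x 1 - Finsupp.single y 1 =
        setOcc Triple.u Triple.a Triple.b S' - Finsupp.single x' 1 - Finsupp.single y' 1 with hC
  set I : Finset (Triple e PH PS) → ι → ι → Finset (Triple e PH PS) → ι → ι → ℝ :=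
    fun S' x' y' S x y => if A' S' x' y' ∧ C S x y S' x' y' then 1 else 0 with hI
  have hI0 : ∀ S' x' y' S x y, 0 ≤ I S' x' y' S x y := by
    intro S' x' y' S x y; simp only [hI]; split_ifs <;> norm_num
  set X : ℝ := ∑ S : Finset (Triple e PH PS), ‖c S‖ ^ 2 * (S.card : ℝ) ^ 2 with hX
  -- (1) the six-fold expansion
  have hexp : ∀ S' : Finset (Triple e PH PS), ∀ x' ∈ PH, ∀ y' ∈ PH,
      (if A' S' x' y' then ∑ x ∈ PH, ∑ y ∈ PH, K x y x' y' *
          fockInner (pderiv y (pderiv x (cubicVector e PH PS κ)))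
            (monomial (setOcc Triple.u Triple.a Triple.b S' - Finsupp.single x' 1 - Finsupp.single y' 1) (c S'))
        else 0) =
      ∑ S : Finset (Triple e PH PS), ∑ x ∈ PH, ∑ y ∈ PH,
        (if A' S' x' y' ∧ C S x y S' x' y' then K x y x' y' * (conj (c S) * c S') else 0) := by
    intro S' x' hx' y' hy'
    by_cases hA : A' S' x' y'
    · rw [if_pos hA]
      have hsq : ∀ i, ((setOcc Triple.u Triple.a Triple.b S' - Finsupp.single x' 1 - Finsupp.single y' 1 :
          ι →₀ ℕ) i) ≤ 1 :=
        fun i => tsub_single_le_one (fun j => tsub_single_le_one (hA.1.setOcc_le_one hHS) x' j) y' i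
      have hin : ∀ x y, K x y x' y' * fockInner (pderiv y (pderiv x (cubicVector e PH PS κ)))
          (monomial (setOcc Triple.u Triple.a Triple.b S' - Finsupp.single x' 1 - Finsupp.single y' 1) (c S')) =
          ∑ S : Finset (Triple e PH PS), (if A' S' x' y' ∧ C S x y S' x' y' then
            K x y x' y' * (conj (c S) * c S') else 0) := by
        intro x y
        rw [fockInner_pderiv_pderiv_cubicVector_monomial_eq_sum hHS κ x y hsq, Finset.mul_sum]
        refine Finset.sum_congr rfl fun S _ => ?_
        simp only [hA, true_and, mul_ite, mul_zero, hC, hc]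
      simp_rw [hin]
      rw [Finset.sum_congr rfl fun x _ => Finset.sum_comm, Finset.sum_comm]
    · rw [if_neg hA]
      refine (Finset.sum_eq_zero fun S _ => Finset.sum_eq_zero fun x _ => Finset.sum_eq_zero fun y _ => ?_).symm
      rw [if_neg (fun h => hA h.1)]
  -- (2) termwise bound
  have hterm : ∀ S' x' y' S x y, ‖(if A' S' x' y' ∧ C S x y S' x' y' then K x y x' y' * (conj (c S) * c S') else 0)‖ ≤
      (K₀ / 2) * (I S' x' y' S x y * ‖c S‖ ^ 2) + (K₀ / 2) * (I S' x' y' S x y * ‖c S'‖ ^ 2) := by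
    intro S' x' y' S x y
    simp only [hI]
    split_ifs with h
    · rw [norm_mul, norm_mul, Complex.norm_conj, one_mul, one_mul]
      have h2 : ‖c S‖ * ‖c S'‖ ≤ (‖c S‖ ^ 2 + ‖c S'‖ ^ 2) / 2 := by
        nlinarith [sq_nonneg (‖c S‖ - ‖c S'‖)]
      calc ‖K x y x' y'‖ * (‖c S‖ * ‖c S'‖) ≤ K₀ * ((‖c S‖ ^ 2 + ‖c S'‖ ^ 2) / 2) :=
            mul_le_mul (hK x y x' y') h2 (by positivity) hK₀
        _ = _ := by ring
    · simp
  -- (3) the two Schur sums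
  have hZ1 : ∑ S' : Finset (Triple e PH PS), ∑ x' ∈ PH, ∑ y' ∈ PH, ∑ S : Finset (Triple e PH PS),
      ∑ x ∈ PH, ∑ y ∈ PH, I S' x' y' S x y * ‖c S'‖ ^ 2 ≤ 16 * X := by
    have hrow : ∀ S' : Finset (Triple e PH PS), ∀ x' ∈ PH, ∀ y' ∈ PH,
        ∑ S : Finset (Triple e PH PS), ∑ x ∈ PH, ∑ y ∈ PH, I S' x' y' S x y * ‖c S'‖ ^ 2 ≤
          4 * ((if A' S' x' y' then (1 : ℝ) else 0) * ‖c S'‖ ^ 2) := by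
      intro S' x' _ y' _
      simp_rw [← Finset.sum_mul]
      rw [← mul_assoc]
      refine mul_le_mul_of_nonneg_right ?_ (sq_nonneg _)
      by_cases hA : A' S' x' y'
      · rw [if_pos hA, mul_one]
        refine le_trans (le_of_eq ?_) (hA.1.sum_exp_partners_le_four he hHS hA.2)
        refine Finset.sum_congr rfl fun S _ => Finset.sum_congr rfl fun x _ => Finset.sum_congr rfl fun y _ => ?_
        simp only [hI, hA, true_and, hC]
      · rw [if_neg hA, mul_zero]
        refine le_of_eq (Finset.sum_eq_zero fun S _ => Finset.sum_eq_zero fun x _ =>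
          Finset.sum_eq_zero fun y _ => ?_)
        simp only [hI, hA, false_and, if_false]
    calc ∑ S' : Finset (Triple e PH PS), ∑ x' ∈ PH, ∑ y' ∈ PH, ∑ S : Finset (Triple e PH PS),
          ∑ x ∈ PH, ∑ y ∈ PH, I S' x' y' S x y * ‖c S'‖ ^ 2
        ≤ ∑ S' : Finset (Triple e PH PS), ∑ x' ∈ PH, ∑ y' ∈ PH,
            4 * ((if A' S' x' y' then (1 : ℝ) else 0) * ‖c S'‖ ^ 2) :=
          Finset.sum_le_sum fun S' _ => Finset.sum_le_sum fun x' hx' => Finset.sum_le_sum fun y' hy' =>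
            hrow S' x' hx' y' hy'
      _ ≤ ∑ S' : Finset (Triple e PH PS), 16 * (‖c S'‖ ^ 2 * (S'.card : ℝ) ^ 2) := by
          refine Finset.sum_le_sum fun S' _ => ?_
          simp_rw [← Finset.mul_sum, ← Finset.sum_mul]
          by_cases hS' : TripleAdm e S'
          · have hle : ∑ x' ∈ PH, ∑ y' ∈ PH, (if A' S' x' y' then (1 : ℝ) else 0) ≤ (2 * S'.card) ^ 2 := by
              rw [← hS'.sum_PH_sum_PH_ite_occupied hHS]
              refine Finset.sum_le_sum fun x' _ => Finset.sum_le_sum fun y' _ => ?_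
              split_ifs with h1 h2
              · exact le_rfl
              · exfalso
                obtain ⟨-, τ₁, h₁, τ₂, h₂, -, hx₁, hy₂⟩ := h1
                refine h2 ⟨?_, ?_⟩
                · rcases hx₁ with hh | hh <;> rw [hh]
                  exacts [(setOcc_slot_ne_zero h₁).1, (setOcc_slot_ne_zero h₁).2.1]
                · rcases hy₂ with hh | hh <;> rw [hh]
                  exacts [(setOcc_slot_ne_zero h₂).1, (setOcc_slot_ne_zero h₂).2.1]
              · norm_num
              · exact le_rfl
            nlinarith [hle, sq_nonneg ‖c S'‖]
          · have h0 : ∑ x' ∈ PH, ∑ y' ∈ PH, (if A' S' x' y' then (1 : ℝ) else 0) = 0 :=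
              Finset.sum_eq_zero fun x' _ => Finset.sum_eq_zero fun y' _ => if_neg (fun h => hS' h.1)
            rw [h0, zero_mul, mul_zero]
            positivity
      _ = 16 * X := by rw [hX, ← Finset.mul_sum]
  have hZ2 : ∑ S' : Finset (Triple e PH PS), ∑ x' ∈ PH, ∑ y' ∈ PH, ∑ S : Finset (Triple e PH PS),
      ∑ x ∈ PH, ∑ y ∈ PH, I S' x' y' S x y * ‖c S‖ ^ 2 ≤ 16 * X := by
    rw [sum_comm₃₃]
    have hcol : ∀ S : Finset (Triple e PH PS), ∀ x ∈ PH, ∀ y ∈ PH,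
        ∑ S' : Finset (Triple e PH PS), ∑ x' ∈ PH, ∑ y' ∈ PH, I S' x' y' S x y * ‖c S‖ ^ 2 ≤
          4 * ((if TripleAdm e S ∧ setOcc Triple.u Triple.a Triple.b S x ≠ 0 ∧
            setOcc Triple.u Triple.a Triple.b S y ≠ 0 then (1 : ℝ) else 0) * ‖c S‖ ^ 2) := by
      intro S x hx y hy
      simp_rw [← Finset.sum_mul]
      rw [← mul_assoc]
      refine mul_le_mul_of_nonneg_right ?_ (sq_nonneg _)
      refine le_trans (le_of_eq ?_) (TripleAdm.sum_exp_partners_le_four' he hHS S hx hy)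
      refine Finset.sum_congr rfl fun S' _ => Finset.sum_congr rfl fun x' _ => Finset.sum_congr rfl fun y' _ => ?_
      simp only [hI, hA', hC]
    calc ∑ S : Finset (Triple e PH PS), ∑ x ∈ PH, ∑ y ∈ PH, ∑ S' : Finset (Triple e PH PS),
          ∑ x' ∈ PH, ∑ y' ∈ PH, I S' x' y' S x y * ‖c S‖ ^ 2
        ≤ ∑ S : Finset (Triple e PH PS), ∑ x ∈ PH, ∑ y ∈ PH,
            4 * ((if TripleAdm e S ∧ setOcc Triple.u Triple.a Triple.b S x ≠ 0 ∧
              setOcc Triple.u Triple.a Triple.b S y ≠ 0 then (1 : ℝ) else 0) * ‖c S‖ ^ 2) :=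
          Finset.sum_le_sum fun S _ => Finset.sum_le_sum fun x hx => Finset.sum_le_sum fun y hy =>
            hcol S x hx y hy
      _ ≤ ∑ S : Finset (Triple e PH PS), 16 * (‖c S‖ ^ 2 * (S.card : ℝ) ^ 2) := by
          refine Finset.sum_le_sum fun S _ => ?_
          simp_rw [← Finset.mul_sum, ← Finset.sum_mul]
          by_cases hS : TripleAdm e S
          · have hle : ∑ x ∈ PH, ∑ y ∈ PH, (if TripleAdm e S ∧ setOcc Triple.u Triple.a Triple.b S x ≠ 0 ∧
                setOcc Triple.u Triple.a Triple.b S y ≠ 0 then (1 : ℝ) else 0) = (2 * S.card) ^ 2 := by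
              rw [← hS.sum_PH_sum_PH_ite_occupied hHS]
              refine Finset.sum_congr rfl fun x _ => Finset.sum_congr rfl fun y _ => ?_
              simp only [hS, true_and]
            rw [hle]
            nlinarith [sq_nonneg ‖c S‖]
          · have h0 : ∑ x ∈ PH, ∑ y ∈ PH, (if TripleAdm e S ∧ setOcc Triple.u Triple.a Triple.b S x ≠ 0 ∧
                setOcc Triple.u Triple.a Triple.b S y ≠ 0 then (1 : ℝ) else 0) = 0 :=
              Finset.sum_eq_zero fun x _ => Finset.sum_eq_zero fun y _ => if_neg (fun h => hS h.1)
            rw [h0, zero_mul, mul_zero]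
            positivity
      _ = 16 * X := by rw [hX, ← Finset.mul_sum]
  -- (4) assemble
  calc ‖∑ S' : Finset (Triple e PH PS), ∑ x' ∈ PH, ∑ y' ∈ PH,
        (if A' S' x' y' then ∑ x ∈ PH, ∑ y ∈ PH, K x y x' y' *
          fockInner (pderiv y (pderiv x (cubicVector e PH PS κ)))
            (monomial (setOcc Triple.u Triple.a Triple.b S' - Finsupp.single x' 1 - Finsupp.single y' 1) (c S'))
        else 0)‖
      = ‖∑ S' : Finset (Triple e PH PS), ∑ x' ∈ PH, ∑ y' ∈ PH, ∑ S : Finset (Triple e PH PS), ∑ x ∈ PH, ∑ y ∈ PH,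
          (if A' S' x' y' ∧ C S x y S' x' y' then K x y x' y' * (conj (c S) * c S') else 0)‖ := by
        rw [Finset.sum_congr rfl fun S' _ => Finset.sum_congr rfl fun x' hx' =>
          Finset.sum_congr rfl fun y' hy' => hexp S' x' hx' y' hy']
    _ ≤ ∑ S' : Finset (Triple e PH PS), ∑ x' ∈ PH, ∑ y' ∈ PH, ∑ S : Finset (Triple e PH PS), ∑ x ∈ PH, ∑ y ∈ PH,
          ((K₀ / 2) * (I S' x' y' S x y * ‖c S‖ ^ 2) + (K₀ / 2) * (I S' x' y' S x y * ‖c S'‖ ^ 2)) :=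
        norm_sum_le_of_le _ fun S' _ => norm_sum_le_of_le _ fun x' _ =>
          norm_sum_le_of_le _ fun y' _ => norm_sum_le_of_le _ fun S _ =>
            norm_sum_le_of_le _ fun x _ => norm_sum_le_of_le _ fun y _ => hterm S' x' y' S x y
    _ = (K₀ / 2) * (∑ S' : Finset (Triple e PH PS), ∑ x' ∈ PH, ∑ y' ∈ PH, ∑ S : Finset (Triple e PH PS),
            ∑ x ∈ PH, ∑ y ∈ PH, I S' x' y' S x y * ‖c S‖ ^ 2) +
          (K₀ / 2) * (∑ S' : Finset (Triple e PH PS), ∑ x' ∈ PH, ∑ y' ∈ PH, ∑ S : Finset (Triple e PH PS),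
            ∑ x ∈ PH, ∑ y ∈ PH, I S' x' y' S x y * ‖c S'‖ ^ 2) := by
        simp only [Finset.sum_add_distrib, Finset.mul_sum]
    _ ≤ (K₀ / 2) * (16 * X) + (K₀ / 2) * (16 * X) := by
        gcongr
    _ = 16 * K₀ * X := by ring

/-- **The second moment with squares**: `∑_S |c_S|²|S|² ≤ ((∑|κ|²)² + ∑|κ|²) ∑_S |c_S|²`
(`|S|² = |S|(|S|-1) + |S|`, [ibid., (5.3)–(5.4)]). [cite: BastiCenatiempoSchlein2021, §5.1 (5.3)–(5.4)] -/
theorem sum_normSq_setCoeff_mul_card_sq_le [Fintype ι] (κ : Triple e PH PS → ℂ) :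
    ∑ S : Finset (Triple e PH PS), ‖setCoeff κ (TripleAdm e) S‖ ^ 2 * (S.card : ℝ) ^ 2 ≤
      ((∑ τ, ‖κ τ‖ ^ 2) ^ 2 + ∑ τ, ‖κ τ‖ ^ 2) *
        ∑ S : Finset (Triple e PH PS), ‖setCoeff κ (TripleAdm e) S‖ ^ 2 := by
  have hher : ∀ S : Finset (Triple e PH PS), TripleAdm e S → ∀ τ ∈ S, TripleAdm e (S.erase τ) :=
    fun S hS τ _ => hS.erase τ
  have h1 := sum_normSq_setCoeff_mul_card_mul_card_sub_one_le (κ := κ) hher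
  have h2 := sum_normSq_setCoeff_mul_sum_le (κ := κ) hher (fun _ => 1) (fun _ => zero_le_one)
  simp only [one_mul, Finset.sum_const, nsmul_eq_mul, mul_one] at h2
  have hsplit : ∀ S : Finset (Triple e PH PS), ‖setCoeff κ (TripleAdm e) S‖ ^ 2 * (S.card : ℝ) ^ 2 =
      ‖setCoeff κ (TripleAdm e) S‖ ^ 2 * ((S.card : ℝ) * ((S.card : ℝ) - 1)) +
        ‖setCoeff κ (TripleAdm e) S‖ ^ 2 * (S.card : ℝ) := fun S => by ring
  simp only [hsplit, Finset.sum_add_distrib]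
  rw [add_mul]
  exact add_le_add h1 h2

/-- **The quartic pairing decomposition** `∑_{x,y,x',y'∈P_H} K ⟨a_ya_xξ_ν, a_{y'}a_{x'}ξ_ν⟩ = V₁ + B`:
the Type-A pairings (the hard pair of one triple annihilated and re-created on the same soft mode,
[BastiCenatiempoSchlein2021, §5.3 case 1)], including the diagonal) give, after freeing the two
triples, `V₁ = ∑_{τ',τ : b_τ=b_{τ'}} κ_{τ'} conj(κ_τ) K̃(τ,τ') (‖ξ_ν‖² - D₂(τ',τ))` with
`K̃(τ,τ') = K(u,a,u',a') + K(u,a,a',u') + K(a,u,u',a') + K(a,u,a',u')` (main term `I_𝒱` of (5.14) plus the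
cutoff error `J_𝒱`, `D₂ ≤ D_{τ'} + D_τ` by `pairDefect_le`); the Type-B pairings (two triples touched,
case 2), `V₂`, and the cross diagonal) are an error `|B| ≤ 16K₀ ∑_S|c_S|²|S|²` for `|K| ≤ K₀`
(`sum_normSq_setCoeff_mul_card_sq_le` turns this into `16K₀((∑|κ|²)²+∑|κ|²)‖ξ_ν‖²`, the analogue of (5.19)).
[cite: BastiCenatiempoSchlein2021, §5.3 (5.12)–(5.14), (5.19)] -/
theorem quartic_pairing_decomposition [Fintype ι] (he : Function.Injective e) (hHS : Disjoint PH PS)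
    (κ : Triple e PH PS → ℂ) (K : ι → ι → ι → ι → ℂ) {K₀ : ℝ} (hK₀ : 0 ≤ K₀)
    (hK : ∀ x y x' y', ‖K x y x' y'‖ ≤ K₀) :
    ∃ B : ℂ, ‖B‖ ≤ 16 * K₀ * ∑ S : Finset (Triple e PH PS), ‖setCoeff κ (TripleAdm e) S‖ ^ 2 * (S.card : ℝ) ^ 2 ∧
      ∑ x ∈ PH, ∑ y ∈ PH, ∑ x' ∈ PH, ∑ y' ∈ PH, K x y x' y' *
          fockInner (pderiv y (pderiv x (cubicVector e PH PS κ))) (pderiv y' (pderiv x' (cubicVector e PH PS κ))) =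
        (∑ τ' : Triple e PH PS, ∑ τ : Triple e PH PS, (if τ.b = τ'.b then
          κ τ' * conj (κ τ) * (K τ.u τ.a τ'.u τ'.a + K τ.u τ.a τ'.a τ'.u + K τ.a τ.u τ'.u τ'.a + K τ.a τ.u τ'.a τ'.u) *
            (((∑ R : Finset (Triple e PH PS), ‖setCoeff κ (TripleAdm e) R‖ ^ 2 : ℝ) : ℂ) -
              ((∑ R : Finset (Triple e PH PS),
                (if ¬ (τ' ∉ R ∧ τ ∉ R ∧ TripleAdm e (insert τ' R) ∧ TripleAdm e (insert τ R)) then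
                  ‖setCoeff κ (TripleAdm e) R‖ ^ 2 else 0) : ℝ) : ℂ)) else 0)) + B := by
  refine ⟨_, norm_quartic_cross_le he hHS κ K hK₀ hK, ?_⟩
  rw [quartic_sum_eq_same_add_cross hHS κ K, quartic_same_eq_typeA_freed hHS κ K]

end QuarticGlue

end Fock

end Literature.MathematicalPhysics.QuantumManyBody.BoseGas

end
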